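import Summits.QuantumFields.YangMills.Theorems.BalabanUVNodesN06AtRecord11ObligationsPins
import Summits.QuantumFields.YangMills.Theorems.BalabanUVNodesN06AtRecord11ObligationsHg
import Summits.QuantumFields.YangMills.Theorems.BalabanUVNodesN06SectBOfFrameV4
import Literature.MathematicalPhysics.QuantumFieldTheory.Balaban1983to89.B9Cor35ComparisonsEH
import Literature.MathematicalPhysics.QuantumFieldTheory.Balaban1983to89.B9Ineq344LocalPairHolds
import Literature.MathematicalPhysics.QuantumFieldTheory.Balaban1983to89.B9Ineq347GAAtLetters
import Literature.MathematicalPhysics.QuantumFieldTheory.Balaban1983to89.B9Thm39ReadingAtLetters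
import Literature.MathematicalPhysics.QuantumFieldTheory.Balaban1983to89.B9Thm314Thm315RecordVacuity
import Literature.MathematicalPhysics.QuantumFieldTheory.Balaban1983to89.Node00.OpsYSectDE
import Literature.MathematicalPhysics.QuantumFieldTheory.Balaban1983to89.B9Thm312WholeLeafRelH
import Literature.MathematicalPhysics.QuantumFieldTheory.Balaban1983to89.B9Thm313WholeLeafRel
import Literature.MathematicalPhysics.QuantumFieldTheory.Balaban1983to89.B9Thm312WholeFacesY
import Literature.MathematicalPhysics.QuantumFieldTheory.Balaban1983to89.B9OpsRTransport
import Literature.MathematicalPhysics.QuantumFieldTheory.Balaban1983to89.B9CarrierBlockMultiplicity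
import Literature.MathematicalPhysics.QuantumFieldTheory.Balaban1983to89.B9CoRealizesRelAtLetters
import Literature.MathematicalPhysics.QuantumFieldTheory.Balaban1983to89.B9Ineq349SiteReading
import Literature.MathematicalPhysics.QuantumFieldTheory.Balaban1983to89.B9Eq3132AtRecordDE
import Literature.MathematicalPhysics.QuantumFieldTheory.Balaban1983to89.B9Thm314Thm315RecordDE
import Literature.MathematicalPhysics.QuantumFieldTheory.Balaban1983to89.B9Thm311ReadingAtLetters
import Literature.MathematicalPhysics.QuantumFieldTheory.Balaban1983to89.B9RWSumsDefinitePinsPairM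
import Literature.MathematicalPhysics.QuantumFieldTheory.Balaban1983to89.B9Thm311SymmAtRecordV4
import Summits.QuantumFields.YangMills.Theorems.BalabanUVNodesN06CoReadingsOfPins
import Literature.MathematicalPhysics.QuantumFieldTheory.Balaban1983to89.B9Eq3132NuReading
import Literature.MathematicalPhysics.QuantumFieldTheory.Balaban1983to89.B9GeoNbrCountKLevelV1
import Literature.MathematicalPhysics.QuantumFieldTheory.Balaban1983to89.Node00.OpsYSectEElim
import Literature.MathematicalPhysics.QuantumFieldTheory.Balaban1983to89.B9Thm311PosAtRecordV4
import Literature.MathematicalPhysics.QuantumFieldTheory.Balaban1983to89.B9CoReadingCoordsH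
import Literature.MathematicalPhysics.QuantumFieldTheory.Balaban1983to89.B9Ineq349SiteFromBlocks
import Literature.MathematicalPhysics.QuantumFieldTheory.Balaban1983to89.Node00.OpsYRecordV4
import Literature.MathematicalPhysics.QuantumFieldTheory.Balaban1983to89.B9Thm315WholeSectERepOn
import Literature.MathematicalPhysics.QuantumFieldTheory.Balaban1983to89.B9CoReadingCoordsTranspose
import Literature.MathematicalPhysics.QuantumFieldTheory.Balaban1983to89.B9CoReadingCoordsL2Pair
import Literature.MathematicalPhysics.QuantumFieldTheory.Balaban1983to89.B9CoReadingCoordsL2S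
import Literature.MathematicalPhysics.QuantumFieldTheory.Balaban1983to89.B9Thm312WholeLeafCompletePairMBZSLR
import Literature.MathematicalPhysics.QuantumFieldTheory.Balaban1983to89.B9RWSumsCompleteGeo9YNbr
import Literature.MathematicalPhysics.QuantumFieldTheory.Balaban1983to89.B9Thm313WholeLeafCompletePairMBCZcUSX
import Literature.MathematicalPhysics.QuantumFieldTheory.Balaban1983to89.Node00.OpsYRecordV4P

/-!
# N06 · rows 20–21 (Theorems 3.12–3.13) at the pins on the S-LEAVES — face v1.3 = v1.2 with SEVEN displayed Z-letters (`hZ7`): `rgd2` (R∇*_UG₁) DERIVED by (3.152) and passed as `hrgd2_13` (dag-n06-l P-DISP; director-ym №272 (5), №285 (R-b), №289 (1); (R3))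

Informal companion: `Summits/QuantumFields/YangMills/informal/balaban_uv_nodes.md` §N06.

v1.3 (this file, seat `pub-ymgap-dag-n06-l` g29; generator `lean/g29/mkSUZ7.py` over v1.2 `…StateSUX` p729393): v1.2 VERBATIM except that the display `hZ8` becomes `hZ7` (its 4th conjunct
`rgd2 : HasMaj 𝔠⁽⁰⁾ 𝔠_W⁽¹⁾ (R ∘ ∇\*_U ∘ G₁ ∘ id) (B12₃·e^{−δ12₃ d})` REMOVED from the display) and the family `hrgd2_13` (same member∕α₀∕U∕Reg prefix, that conjunct's shape) is
ADDED — the certificate derives it by `…N06Rgd2LegAtPinsPhysPU.hrgd2_of_pinsP_geo9Y` (dag-n06-l g16's `rgd2_of_ids3152`: (3.152) `RD\*G₁ = RG′D\*` + Thm 3.1 + (3.49)) fed with its own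
member-wise `Ids3152`; the row-21 leaf receives the 8-conjunction REBUILT from `hZ7` + `hrgd2_13`.  Conclusion IDENTICAL.  One GAP-STATED display fewer; NOT a flag item.
v1.2 (p729393's text): v1.1 VERBATIM except that
row 21 is keyed on the (R3) S-leaf `B9Thm313WholeLeafCompletePairMBCZcUSX.thm313Printed_completePairMBCZcUSX`, so the binder `hletters13 : … → Letters313Zc (𝔬12 x) (Gp x) …
B12₃ δ12₃ (bXH x U) U` is REPLACED by the certificate's own eight-letter display `hZ8` (gD2 gQs2 gQs1 rgd2 c1_2 c1_1 q2 q1 at B12₃ δ12₃) + the derived (3.44) member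
`hwGp13` (from `…N06WGpLegAtPinsPhysPU.hwGp_of_pinsP_geo9Y`) + ONE numeric `hADB12 : 2·AD ≤ B12₃`; the record's former field `gXH` (G₁∇\*_U INTO bXH) is DERIVED INSIDE
the leaf from `hst11` (dag-n06-d g19's RATE MISMATCH on the legged route; LOCATED-U8″ on the raw-class route) — the pin `𝔖₁ = bXH` is `rfl` here.  Conclusion IDENTICAL.
v1.1 (p726695's text):
`…StateSU.t312_t313_of_pins_stateSU` VERBATIM except that row 21 is keyed on dag-n06-l's tDv-FREE S-leaf `B9Thm313WholeLeafCompletePairMBCZcUST.thm313Printed_completePairMBCZcUST`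
(p724752): the binder `hLIM : … → Letters313IMBC (𝔬12 x) (𝔭A x) … (fun ε => θV13 ε·(Mα₀)) …` — a record whose right-form field `tDv : (Δ′_π+Δ⁽²⁾_π)∘G₀∇_U : bHW ε → 𝔠⁽¹⁾`
(LOCATED-U8″: T's leading ∇_U un-absorbed on the output side) no consumer ever read — is REPLACED by the three read families `hrgdd13 ∕ hdgDvd13 ∕ hpdgDvd13` (same member∕α₀∕U∕Reg
prefix; shapes of `Letters313IMBC.rgdd ∕ dgDvd ∕ pdgDvd` at `bHX12 x ε ∕ bHW13 x U ε ∕ Br13 ∕ Bd13 ∕ Bd2₁₃ ∕ δ12₃`), and the letter `θV13` with `hθV13` is GONE; the certificate edition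
that calls this face displays those three families instead of `hLIM` (its `…StateProducersBAtPinsPUD` already takes `hdgDvd` = family 2).  Conclusion IDENTICAL.

WHAT (p723450's text).  The rows-20∕21 face of the certificate of record, `…N06Thm312313AtPinsPairMBCZcRCU.t312_t313_of_pins_pairMBCZc_physRCU` (p698048's species: class-parametric carrier
`bg9YR R₁ R₂`, `U`-dependent Hölder intermediates `bH13 ∕ bXH ∕ bHW13`), RE-KEYED on dag-n06-l's S-LEAVES `B9Thm312WholeLeafCompletePairMBZSLR.thm312Printed_completePairMBZSL_rates`
(row 20, p718619) and `B9Thm313WholeLeafCompletePairMBCZcUS.thm313Printed_completePairMBCZcUS` (row 21; here: its tDv-free twin `…MBCZcUST`, p724752): the leaves that read the perturbation step and the one-step pairs OUT OF A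
REGULAR STATE CLASS 𝔖 instead of the raw sup class — so that the Δ⁽²⁾ letters `hta₂ hta₂R htb₂ htb₂R` (refuted as raw-class species, LOCATED-U8) are no longer displayed anywhere.

BINDER LEDGER versus the RCU face (everything else VERBATIM): REMOVED `θ12 hθ12` (the raw-class step constant), `θI12 hθI12` (the ε-indexed raw input step), `hleft12` (`LeftStep`),
`hstepC` (`StepDirB ∧ StepL2`) and the `Thm33G0 ∧ Step ∧ Step` conjuncts of `hmodel12` (now `FormSmall ∧ Identities`); RETYPED `hρδ12 : ρ12 + 2σ12 ≤ δK12` (the S-leaves' rate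
budget); ADDED the state letters `θS κS A₀S AW AQ AD AQ1 CR δP AI AV` with signs, `hκ13S : κ13 ≤ κS`, the rate budget `hρP12 : ρ12 + 2σ12 ≤ δP ≤ δ12₃ (≤ δ12₀)`, `hStL` (`StepL2` alone),
`he1` (the (3.43) homogeneous majorant of ∇_UG₀, Theorem 3.3), the ℓ¹ controls `hdomX ∕ hdomW` of `bHX12 ε` ∕ `bHW13 U ε`-localised inputs ((R-b): `∃ Λ ≥ 0, IsLoc y μ → Σ|μ| ≤ Λ·loc`,
discharged at the pins by `B9StateAprioriL1.exists_l1_control_bHK ∕ _bHS`), and the four STATE TUPLES `hst20 hst10 hst21 hst11` (rows 20∕21 on `𝔖₂ := weightNorm (bXH x U) (rwt (−1))`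
∕ `𝔖₁ := bXH x U`) — exactly the conclusion of `…N06StateAssemblyAtPinsPU.hStateAssembly_of_faces` read at `H := H12`, `bHXA := bHX12`, `bHX := fun x => bHW13 x U`, `Dsd := Dds`.
The two leaf applications pass `𝔖₂ := fun x U => weightNorm (bXH x U) (rwt (geo9Y x) (−1)) _`, `𝔖₁ := bXH`, `δQ := δP`, `CR₁ := CR`, `hκ2 ∕ hκ1` from `hκX` + `hκ13S` (`weightNorm_κ`).

HONEST LABEL: Bałaban's theorems AS PRINTED over finite tori; helper, count-neutral; N06 NOT discharged by this file; nothing continuum ∕ OS ∕ mass gap ∕ Clay.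
[cite: Balaban1985BackgroundPropagators, Thm 3.12 pp.421–423, Thm 3.13 pp.423–426, (3.130)–(3.133) pp.421–422, (3.137)–(3.138) p.423, (3.151)–(3.153) p.426, (3.42)–(3.47) pp.397–398, (3.35)–(3.36) p.396; Balaban1984PropagatorsII, (2.51)–(2.56) pp.232–233, Lemma 2.1 (2.60)–(2.61) p.234]
-/

noncomputable section

namespace Summit.QuantumFields.YangMills.BalabanUVNodes.N06Thm312313AtPinsStateSUZ7


open Literature.MathematicalPhysics.QuantumFieldTheory.Balaban1983to89.B9BackgroundsKLevelV1R (RegFamY bg9YR MemOfFam mem_of_reg335R kernelFamilyR kernelFamilyRY hKernelR hKernelRY) open Literature.MathematicalPhysics.QuantumFieldTheory.Balaban1983to89.B9OpsRTransport (ops312RY)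
open Literature.MathematicalPhysics.QuantumFieldTheory.Balaban1983to89 open Literature.MathematicalPhysics.QuantumFieldTheory.Balaban1983to89.T4Continuum (T4Family) open Literature.MathematicalPhysics.QuantumFieldTheory.Balaban1983to89.DagBinding (WorldP leavesP) open Literature.MathematicalPhysics.QuantumFieldTheory.Balaban1983to89.Node00 open Literature.MathematicalPhysics.QuantumFieldTheory.Balaban1983to89.B9PinMembersKLevelV1 (MemberY geo9Y bg9Y) open Literature.MathematicalPhysics.QuantumFieldTheory.Balaban1983to89.B9PinGeometryKLevelV1 (dOmegaY OmKY inΛY unitDistY InCubeY c35Y c35Y_pos) open Literature.MathematicalPhysics.QuantumFieldTheory.Balaban1983to89.B7Prop2SpecialUnitary (specialUnitaryUnits specialUnitaryUnits_le_unitaryUnits) open Literature.MathematicalPhysics.QuantumFieldTheory.Balaban1983to89.B9Ineq347GAAtLetters (hGA_opsYOfLetters) open Literature.MathematicalPhysics.QuantumFieldTheory.Balaban1983to89.B9Ineq344LocalPairHolds (hGp_opsYOfLetters_holds) open Literature.MathematicalPhysics.QuantumFieldTheory.Balaban1983to89.B9Cor35ComparisonsGAAtLetters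
  (hGA_e_opsYOfLetters hGA_h1_opsYOfLetters hGA_e4_opsYOfLetters hGA_h2_opsYOfLetters hGA_l2_opsYOfLetters)
open Literature.MathematicalPhysics.QuantumFieldTheory.Balaban1983to89.B9Cor35ComparisonsGpCAtLetters (hGp_e_opsYOfLetters hGp_h1_opsYOfLetters hC_opsYOfLetters) open Literature.MathematicalPhysics.QuantumFieldTheory.Balaban1983to89.B9Cor35ComparisonsEH (hE4_of_hGA_e4 hH2_of_hGA_h2) open Literature.MathematicalPhysics.QuantumFieldTheory.Balaban1983to89.B9Thm314Thm315RecordVacuity (thm315FullPrinted_of_ker_zero) open Literature.MathematicalPhysics.QuantumFieldTheory.Balaban1983to89.B9RecordDELettersVacuity (siteKernelOfOp_zero_ker fineKernelOfOp_zero_ker stmt349Printed_of_ker_zero) open Literature.MathematicalPhysics.QuantumFieldTheory.Balaban1983to89.B9GeoLemma21KLevelV1 (geo9Y_len_pos) open Literature.MathematicalPhysics.QuantumFieldTheory.Balaban1983to89.B9Thm311Whole (PosDefOfOps) open Literature.MathematicalPhysics.QuantumFieldTheory.Balaban1983to89.B9Thm39Whole (WalkReading39) open Literature.MathematicalPhysics.QuantumFieldTheory.Balaban1983to89.B9Thm39WholeBlk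 (Ops39Blk StaticOK39Blk Locality39Blk Local348Blk Identities395Blk Small285Blk Factors389Blk)
open Literature.MathematicalPhysics.QuantumFieldTheory.Balaban1983to89.B9Thm39WholeBlkViaDatum (EK39OfOpsBlkVia) open Literature.MathematicalPhysics.QuantumFieldTheory.Balaban1983to89.B9Thm39ReadingCoords (repSite39) open Literature.MathematicalPhysics.QuantumFieldTheory.Balaban1983to89.B9Thm39ReadingAtLetters (X39 blk39 L39 t39_hksum_of_pins_opsYOfLetters) open Literature.MathematicalPhysics.QuantumFieldTheory.Balaban1983to89.B9RowSum261DefiniteFaces (rowConst261) open Summit.QuantumFields.YangMills.BalabanUVNodes.N06AtRecord11ObligationsPins (t311_of_pin) open Summit.QuantumFields.YangMills.BalabanUVNodes.N06AtRecord11ObligationsHg (hg_obligation_vacuous) open Summit.QuantumFields.YangMills.BalabanUVNodes.N06AtRecord11CB10YZW (b9_main_of_up_view₁₁B10YZW_of_obligations) open Literature.MathematicalPhysics.QuantumFieldTheory.Balaban1983to89.B9Thm312Whole (GeoOK Thm33G0 FormSmall HasRWExpOfOps HasRWExpHOfOps PosDefKOfOps) open Literature.MathematicalPhysics.QuantumFieldTheory.Balaban1983to89.B11SectG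 (RowSum BlockNorm) open Literature.MathematicalPhysics.QuantumFieldTheory.Balaban1983to89.B9FromB6 (L2Block) open Literature.MathematicalPhysics.QuantumFieldTheory.Balaban1983to89.B9Thm312WholeH (LettersH) open Literature.MathematicalPhysics.QuantumFieldTheory.Balaban1983to89.B9Thm312WholeLeft (LeftStep)
open Literature.MathematicalPhysics.QuantumFieldTheory.Balaban1983to89.B9Thm313WholeLeft (Letters313D) open Literature.MathematicalPhysics.QuantumFieldTheory.Balaban1983to89.B9Thm313Whole (Letters313) open Literature.MathematicalPhysics.QuantumFieldTheory.Balaban1983to89.B9Ineq347CoReading (CoReadsGlob) open Literature.MathematicalPhysics.QuantumFieldTheory.Balaban1983to89.B9Thm312WholeFacesY (lemma21AboveG_geo9Y) open Literature.MathematicalPhysics.QuantumFieldTheory.Balaban1983to89.B9GeoNormsKLevelV1 (geo9K_dist_nonneg) open Literature.MathematicalPhysics.QuantumFieldTheory.Balaban1983to89.B9GeoLemma21KLevelV1 (distOK_geo9Y rowSum261_geo9Y geo9Y_dist_triangle geo9Y_dist_comm) open Literature.MathematicalPhysics.QuantumFieldTheory.Balaban1983to89.B9GeoNormsKLevelModelSignsV1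 (modelSignsOn_geo9K) open Literature.MathematicalPhysics.QuantumFieldTheory.Balaban1983to89.B9Thm34Ext (toB6) open Literature.MathematicalPhysics.QuantumFieldTheory.Balaban1983to89.B9CoRealizesRel (CoRealizesRel) open Literature.MathematicalPhysics.QuantumFieldTheory.Balaban1983to89.B9CoRealizesRelAtLetters (RelB maj342_relB_left maj342_relB_right dist_eq_of_relB len_eq_of_relB relB_refl)
open Literature.MathematicalPhysics.QuantumFieldTheory.Balaban1983to89.B9CoRealizesHRel (CoRealizesHRel) open Literature.MathematicalPhysics.QuantumFieldTheory.Balaban1983to89.B9SectCDiffDict (maj342) open Literature.MathematicalPhysics.QuantumFieldTheory.Balaban1983to89.B6Ineq2142KLevelV1 (β) open Literature.MathematicalPhysics.QuantumFieldTheory.Balaban1983to89.B9CarrierBlockMultiplicity (card_sameCarrier_le_kIdx) open Literature.MathematicalPhysics.QuantumFieldTheory.Balaban1983to89.B9Thm312WholeLeafRelH (thm312Printed_of_stepRelH) open Literature.MathematicalPhysics.QuantumFieldTheory.Balaban1983to89.B9Thm313WholeLeafRel (thm313Printed_of_stepRel) open Literature.MathematicalPhysics.QuantumFieldTheory.Balaban1983to89.B9Eq3132SectDLetters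 (QGQY) open Literature.MathematicalPhysics.QuantumFieldTheory.Balaban1983to89.B9Eq3132CTInputs (CoerciveUnder DecayUnder) open Literature.MathematicalPhysics.QuantumFieldTheory.Balaban1983to89.B9Eq3132ScalarIndex (geoComap) open Literature.MathematicalPhysics.QuantumFieldTheory.Balaban1983to89.B9Eq3132RingInverseReading (normMatY) open Literature.MathematicalPhysics.QuantumFieldTheory.Balaban1983to89.B9Ineq349SiteReading (opsYS349OfRecordDE) open Literature.MathematicalPhysics.QuantumFieldTheory.Balaban1983to89.B9Eq3132AtRecordDE (s3132_opsYOfRecordDE)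
open Literature.MathematicalPhysics.QuantumFieldTheory.Balaban1983to89.B9Thm314Thm315RecordDE (thm314_pair_opsYOfRecordDE t315_opsYOfRecordDE_of_slots) open Literature.MathematicalPhysics.QuantumFieldTheory.Balaban1983to89.B9Thm311ReadingAtLetters (ops311Y) open Literature.MathematicalPhysics.QuantumFieldTheory.Balaban1983to89.B9Thm311ReadingCoords (PosDefTr) open Literature.MathematicalPhysics.QuantumFieldTheory.Balaban1983to89.B9Thm311SymmAtRecordV4 (proofLettersOneV4) open Literature.MathematicalPhysics.QuantumFieldTheory.Balaban1983to89.B9Thm311PosAtRecordV4 (t311_of_pins_opsYOfLettersV4₁) open Literature.MathematicalPhysics.QuantumFieldTheory.Balaban1983to89.B9PinGeometryKLevelV1 (kLab) open Literature.MathematicalPhysics.QuantumFieldTheory.Balaban1983to89.B9Thm314GpFlatTorusGeometry (tdistK OmegaC) open Literature.MathematicalPhysics.QuantumFieldTheory.Balaban1983to89.B9Thm314WholePinGeometry (locDataY) open Literature.MathematicalPhysics.QuantumFieldTheory.Balaban1983to89.B9Thm314WholePair (locData₂) open Literature.MathematicalPhysics.QuantumFieldTheory.Balaban1983to89.B9Thm314WholePairWalks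 (pairWalkSets) open Literature.MathematicalPhysics.QuantumFieldTheory.Balaban1983to89.B9Thm314WholeSummation (WalkSetsSpec WalkWeightsSummable) open Literature.MathematicalPhysics.QuantumFieldTheory.Balaban1983to89.B9SectCWalkTermsAllNorms (Thm310AllNormsPrinted) open Literature.MathematicalPhysics.QuantumFieldTheory.Balaban1983to89.B9Thm314WholeExpansionReads (ExpansionReads) open Literature.MathematicalPhysics.QuantumFieldTheory.Balaban1983to89.B9Thm314WholeCancellationLayer (pairOp) open Literature.MathematicalPhysics.QuantumFieldTheory.Balaban1983to89.B9Thm37Whole (Ops Sizes StaticOK Local342 Identities)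
open Literature.MathematicalPhysics.QuantumFieldTheory.Balaban1983to89.B9Cor38Whole (WalkReading Locality) open Literature.MathematicalPhysics.QuantumFieldTheory.Balaban1983to89.B9Thm310Whole (Ops310 WalkReading310 Sizes310 StaticOK310 Locality310 Local342G Identities310) open Literature.MathematicalPhysics.QuantumFieldTheory.Balaban1983to89.B9RWSumsDefinitePins (PinPrims) open Literature.MathematicalPhysics.QuantumFieldTheory.Balaban1983to89.B9RWSumsDefinitePinsPair (PairPrims) open Literature.MathematicalPhysics.QuantumFieldTheory.Balaban1983to89.B9RWSumsDefinitePinsPairM (MixedPrims E37YPairM E310YPairM rows131819_definite_geo9Y_pairM) open Literature.MathematicalPhysics.QuantumFieldTheory.Balaban1983to89.B9RWSums344InputFam (InputReadsFam sliceProbe) open Literature.MathematicalPhysics.QuantumFieldTheory.Balaban1983to89.B9RWSums344InputPair (InputLegsPair37 FactorsInputPair37 DirSupHolder37 InputLegsPair310 FactorsInputPair310 DirSupHolder310) open Literature.MathematicalPhysics.QuantumFieldTheory.Balaban1983to89.B9RWSums346MixedPair (L2MixedLegs37 FactorsL2Mixed37 DirSup37 L2MixedLegs310 FactorsL2Mixed310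 DirSup310) open Literature.MathematicalPhysics.QuantumFieldTheory.Balaban1983to89.B9CoReadingCoordsTranspose (TrIdx trBasis isTransposePair_GcoK_trBasis isTransposePair_DcoK_GcoK_trBasis isTransposePair_GcoS_trBasis isTransposePair_DcoS_GcoS_trBasis) open Literature.MathematicalPhysics.QuantumFieldTheory.Balaban1983to89.B9Thm311SymmAtRecordV4 (symm0_parSymY symmG_parSymY) open Literature.MathematicalPhysics.QuantumFieldTheory.Balaban1983to89.B9Thm311AdjointPairs (GpY_isSymmTr) open Literature.MathematicalPhysics.QuantumFieldTheory.Balaban1983to89.B9RWSums346SecondDiff (familyOp DirOps310 DirTranspose310 L2SecondLegs310 FactorsL2Second310) open Literature.MathematicalPhysics.QuantumFieldTheory.Balaban1983to89.B9RWSums346SecondDiffGp (DirOps37 DirTranspose37 L2SecondLegs37 FactorsL2Second37) open Literature.MathematicalPhysics.QuantumFieldTheory.Balaban1983to89.B9Thm37Glue (IsTransposePair) open Literature.MathematicalPhysics.QuantumFieldTheory.Balaban1983to89.B9RWSums343to347Whole (GlobReads) open Literature.MathematicalPhysics.QuantumFieldTheory.Balaban1983to89.B9RWSumsReadsNbr (nbr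 L2ReadsNbr H1ReadsNbr InputReadsNbr) open Literature.MathematicalPhysics.QuantumFieldTheory.Balaban1983to89.B9RWSums346Two (L2TwoLegs310 FactorsL2_310) open Literature.MathematicalPhysics.QuantumFieldTheory.Balaban1983to89.B9RWSums346TwoGp (L2TwoLegs37 FactorsL2_37) open Literature.MathematicalPhysics.QuantumFieldTheory.Balaban1983to89.B9RWSums344Input (InputLegs310 FactorsInput310)
open Literature.MathematicalPhysics.QuantumFieldTheory.Balaban1983to89.B9RWSums344InputGp (InputLegs37 FactorsInput37) open Literature.MathematicalPhysics.QuantumFieldTheory.Balaban1983to89.B9RWSums343Holder (HolderProbes HolderLegs310 FactorsHolder310) open Literature.MathematicalPhysics.QuantumFieldTheory.Balaban1983to89.B9RWSums343HolderGp (HolderLegs37 HolderV37) open Literature.MathematicalPhysics.QuantumFieldTheory.Balaban1983to89.B9SectBStepFrameV4 (SectBFrame₄) open Summit.QuantumFields.YangMills.BalabanUVNodes.N06SectBOfFrameV4 (hB_obligation_of_sectBFrame₄)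
open Literature.MathematicalPhysics.QuantumFieldTheory.Balaban1983to89.B9CoReadingCoords (XBK evBK blkBK GcoK DcoK DscoK LcoK coordOpK cdBₗ cdsBₗ) open Literature.MathematicalPhysics.QuantumFieldTheory.Balaban1983to89.B9CoReadingCoordsS (XSK evSK blkSK sIK sIK_faithful GcoS DcoS DscoS LcoS) open Literature.MathematicalPhysics.QuantumFieldTheory.Balaban1983to89.B9CoReadingCoordsL2S (sIK_dist_le_one site_l2ReadsNbr012_of_pins site_l2ReadsNbr345_of_pins) open Literature.MathematicalPhysics.QuantumFieldTheory.Balaban1983to89.B9CoReadingCoordsL2Pair (bond_l2ReadsNbr345_of_pins) open Literature.MathematicalPhysics.QuantumFieldTheory.Balaban1983to89.B9Ineq349SiteComposite (cdSL cdsSL) open Literature.MathematicalPhysics.QuantumFieldTheory.Balaban1983to89.B9Thm312WholeLeafCompletePairM (thm312Printed_completePairM) open Literature.MathematicalPhysics.QuantumFieldTheory.Balaban1983to89.B9RWSumsCompleteGeo9YNbr (len_le_of_dist_le_two_geo9Y one_le_L_nat) open Literature.MathematicalPhysics.QuantumFieldTheory.Balaban1983to89.B9Thm312WholeDir (Thm33G0Dir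 Thm33G0L2M StepDir) open Literature.MathematicalPhysics.QuantumFieldTheory.Balaban1983to89.B9Thm312WholeL2 (StepL2) open Literature.MathematicalPhysics.QuantumFieldTheory.Balaban1983to89.B9Thm312WholeHHolder (LettersHH) open Literature.MathematicalPhysics.QuantumFieldTheory.Balaban1983to89.B9Thm312WholeHHolderNbr (CoReadsHHolderNbr) open Literature.MathematicalPhysics.QuantumFieldTheory.Balaban1983to89.B9Thm311ReadingCoords (IsSymmTr) open Summit.QuantumFields.YangMills.BalabanUVNodes.N06CoReadingsOfPins (bond_coReadings3_of_pins bond_coReadingsLap_of_pins site_coReadings4_of_pins bond_l2ReadsNbr3_of_pins) open Literature.MathematicalPhysics.QuantumFieldTheory.Balaban1983to89.B6Geom246MultiLevelTorus (geomT)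
open Literature.MathematicalPhysics.QuantumFieldTheory.Balaban1983to89.B9Eq3132NuReading (opsYS349NuOfLetters lamInvY) open Literature.MathematicalPhysics.QuantumFieldTheory.Balaban1983to89.B9GeoNbrCountKLevelV1 (nbrM₀Y nbrCountY hnbr_two_of_le) open Literature.MathematicalPhysics.QuantumFieldTheory.Balaban1983to89.B9CoReadingCoordsH (XHK blkHK HcoK coRealizesHRel_of_pins)
open Literature.MathematicalPhysics.QuantumFieldTheory.Balaban1983to89.B9Ineq349SiteFromBlocks (Thm31SiteSchemas Thm32BlkSchema stmt349Printed_site_of_blockSchemas) open Literature.MathematicalPhysics.QuantumFieldTheory.Balaban1983to89.B6GlobalChartV1 (blkV1) open Literature.MathematicalPhysics.QuantumFieldTheory.Balaban1983to89.B6Ineq2142KLevelV1 (lvl) open Literature.MathematicalPhysics.QuantumFieldTheory.Balaban1983to89.B9Thm315WholeSectERep (LocalOuterY) open Literature.MathematicalPhysics.QuantumFieldTheory.Balaban1983to89.B9Thm315WholeSectERepOn (DecayMidOnY t315_opsYSectE_of_3185_on) open Literature.MathematicalPhysics.QuantumFieldTheory.Balaban1983to89.B9Thm314WholeCancellationLayer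 (thm314_pair_layerOfLetters) open Literature.MathematicalPhysics.QuantumFieldTheory.Balaban1983to89.B9Thm314WholePinGeometry (locDataY_laws) open Literature.MathematicalPhysics.QuantumFieldTheory.Balaban1983to89.B9PinGeometryKLevelV1 (dOmegaY_nonneg) open scoped Matrix.Norms.L2Operator
open Literature.MathematicalPhysics.QuantumFieldTheory.Balaban1983to89.B9Thm313WholeLeafCompletePairMBCZcUSX (thm313Printed_completePairMBCZcUSX) open Literature.MathematicalPhysics.QuantumFieldTheory.Balaban1983to89.B9Thm313WholeLettersCut (Letters313Zc Letters313HZc Letters313L2Pc) open Literature.MathematicalPhysics.QuantumFieldTheory.Balaban1983to89.B9Thm313WholeRgdFrom3152 (Ids3152) open Literature.MathematicalPhysics.QuantumFieldTheory.Balaban1983to89.B9Thm313WholeDirInputBC (Letters313IMBC) open Literature.MathematicalPhysics.QuantumFieldTheory.Balaban1983to89.B9Thm313WholeZ (Letters313Z) open Literature.MathematicalPhysics.QuantumFieldTheory.Balaban1983to89.B9Thm313WholeLeftZ (Letters313DZ) open Literature.MathematicalPhysics.QuantumFieldTheory.Balaban1983to89.B9Thm313WholeDirZ (Letters313DMZ)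 open Literature.MathematicalPhysics.QuantumFieldTheory.Balaban1983to89.B9Thm313WholeHolderZ (Letters313HZ) open Literature.MathematicalPhysics.QuantumFieldTheory.Balaban1983to89.B9Thm313WholeL2GPZ (Letters313L2PZ) open Literature.MathematicalPhysics.QuantumFieldTheory.Balaban1983to89.B9Thm313WholeDirL2Z (Letters313L2MZ) open Literature.MathematicalPhysics.QuantumFieldTheory.Balaban1983to89.B9Thm312WholeLeafCompletePairMBZSLR (thm312Printed_completePairMBZSL_rates) open Literature.MathematicalPhysics.QuantumFieldTheory.Balaban1983to89.B9Thm312WholeHZ (LettersHZ LettersHHZ) open Literature.MathematicalPhysics.QuantumFieldTheory.Balaban1983to89.B9SectDSup (weightNorm) open Literature.MathematicalPhysics.QuantumFieldTheory.Balaban1983to89.B9Thm312WholeDirB (StepDirB) open Literature.MathematicalPhysics.QuantumFieldTheory.Balaban1983to89.B9Thm313WholeDirInputB (Letters313IMB) open Literature.MathematicalPhysics.QuantumFieldTheory.Balaban1983to89.B9Thm313WholeDir (Thm33G0DirR Letters313DM Letters313L2M Letters313IM) open Literature.MathematicalPhysics.QuantumFieldTheory.Balaban1983to89.B9Thm313WholeHolder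 (Letters313H) open Literature.MathematicalPhysics.QuantumFieldTheory.Balaban1983to89.B9Thm313WholeL2GP (Letters313L2P)

open B9Thm312WholeStepRegular (StepS) open B6RandomWalkHom (HasMajorantHom) open B9Thm312WholeClasses (cNormR rwt rwt_nonneg) open B9Thm312Whole (cNorm) open B11SectG (HasMaj) open B9SectDSup (weightNorm_κ)

variable {N : ℕ}

section Pointed

set_option maxHeartbeats 400000 in
set_option synthInstance.maxSize 512 in
/-- ★★ **ROWS 20–21 AT THE PINS ON THE S-LEAVES (U8 re-leaf): class-parametric carrier `bg9YR R₁ R₂`, `U`-dependent Hölder intermediates `bH13 bXH bHW13`, the step and the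
one-step pairs read out of the regular state classes `𝔖₂ ∕ 𝔖₁` (the four displayed state tuples `hst20 hst10 hst21 hst11`), NO raw Δ⁽²⁾ letter** (module docstring).
[cite: Balaban1985BackgroundPropagators, Thm 3.12 pp.421–423, Thm 3.13 pp.423–426, (3.130)–(3.133) pp.421–422, (3.138) p.423, (3.151)–(3.153) p.426, (3.35)–(3.36) p.396; Balaban1984PropagatorsII, (2.51)–(2.56) pp.232–233, Lemma 2.1 (2.60)–(2.61) p.234] -/
theorem t312_t313_of_pins_stateSUZ7 (θ : Stage3Params) (Mstar : ℕ) {R₁ R₂ : RegFamY θ.d₆ θ.ℓ₆ θ.hd' θ.hL' θ.b₀ θ.b₁ Mstar (Matrix (Fin N) (Fin N) ℂ)}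
    (hGR : MemOfFam (specialUnitaryUnits (Fin N)) R₁) (c : ℝ) (𝔯 : ResY N θ Mstar) (𝔢 : SectEY N θ Mstar) (𝔴 : RWEY N θ Mstar) (𝔈 : ExpsY N θ Mstar)
    [∀ x : MemberY θ.d₆ θ.ℓ₆ θ.hd' θ.hL' θ.b₀ θ.b₁ Mstar, Fintype (geo9Y x).Site] [∀ x : MemberY θ.d₆ θ.ℓ₆ θ.hd' θ.hL' θ.b₀ θ.b₁ Mstar, DecidableEq (geo9Y x).Site] [∀ x : MemberY θ.d₆ θ.ℓ₆ θ.hd' θ.hL' θ.b₀ θ.b₁ Mstar, DecidableRel (RelB x.toKIdx)]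
    (bI : ∀ x : MemberY θ.d₆ θ.ℓ₆ θ.hd' θ.hL' θ.b₀ θ.b₁ Mstar, FBondY x.toKIdx → IBondY x.toKIdx)
    (hβI : ∀ (x : MemberY θ.d₆ θ.ℓ₆ θ.hd' θ.hL' θ.b₀ θ.b₁ Mstar) (f : FBondY x.toKIdx) (c : IBondY x.toKIdx), blkV1 x.hN x.D f = β x.hN x.D x.hk c → β x.hN x.D x.hk (bI x f) = blkV1 x.hN x.D f)
    (hlev : ∀ (x : MemberY θ.d₆ θ.ℓ₆ θ.hd' θ.hL' θ.b₀ θ.b₁ Mstar) (f : FBondY x.toKIdx), lvl x.hN x.D x.hk (bI x f) = (blkV1 x.hN x.D f).1.1)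
    (hβ1 : ∀ (x : MemberY θ.d₆ θ.ℓ₆ θ.hd' θ.hL' θ.b₀ θ.b₁ Mstar) (f : FBondY x.toKIdx), (geomT x.D).dist (β x.hN x.D x.hk (bI x f)) (blkV1 x.hN x.D f) ≤ 1)
    (hM₀ : nbrM₀Y θ.d₆ θ.ℓ₆ θ.hd' θ.hL' θ.b₀ θ.b₁ 2 ≤ Mstar) {PXA PYA : MemberY θ.d₆ θ.ℓ₆ θ.hd' θ.hL' θ.b₀ θ.b₁ Mstar → Type} [∀ x, Fintype (PXA x)] [∀ x, DecidableEq (PXA x)] [∀ x, Fintype (PYA x)] [∀ x, DecidableEq (PYA x)]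
    (𝔭A : ∀ x : MemberY θ.d₆ θ.ℓ₆ θ.hd' θ.hL' θ.b₀ θ.b₁ Mstar, HolderProbes (geo9Y x) (bg9YR (Matrix (Fin N) (Fin N) ℂ) (specialUnitaryUnits (Fin N)) R₁ R₂ x) (XBK (TrIdx N) x.toKIdx) (XBK (TrIdx N) x.toKIdx) (PXA x) (PYA x))
    -- the single-direction letters ∇_{U,μ} ∕ ∇*_{U,μ} on the bond carrier (in the certificate: `(𝔡A x).Dd ∕ .Dsd` of the Theorem-3.10 letters), PINNED to the coordinate letters
    (Dd Dds : ∀ x : MemberY θ.d₆ θ.ℓ₆ θ.hd' θ.hL' θ.b₀ θ.b₁ Mstar, (bg9YR (Matrix (Fin N) (Fin N) ℂ) (specialUnitaryUnits (Fin N)) R₁ R₂ x).Cfg → Fin (θ.d₆ + 1) → Module.End ℝ (XBK (TrIdx N) x.toKIdx → ℝ))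
    (hDd : ∀ (x : MemberY θ.d₆ θ.ℓ₆ θ.hd' θ.hL' θ.b₀ θ.b₁ Mstar) (U : (bg9YR (Matrix (Fin N) (Fin N) ℂ) (specialUnitaryUnits (Fin N)) R₁ R₂ x).Cfg), Dd x U = fun μ => coordOpK (trBasis N) (fun _ : Fin (θ.d₆ + 1) => cdBₗ x.toKIdx U μ)) (hDds : ∀ (x : MemberY θ.d₆ θ.ℓ₆ θ.hd' θ.hL' θ.b₀ θ.b₁ Mstar) (U : (bg9YR (Matrix (Fin N) (Fin N) ℂ) (specialUnitaryUnits (Fin N)) R₁ R₂ x).Cfg), Dds x U = fun μ => coordOpK (trBasis N) (fun _ : Fin (θ.d₆ + 1) => cdsBₗ x.toKIdx U μ))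
    {W12 : MemberY θ.d₆ θ.ℓ₆ θ.hd' θ.hL' θ.b₀ θ.b₁ Mstar → Type} [∀ x, Fintype (W12 x)]
    (𝔬12 : ∀ x : MemberY θ.d₆ θ.ℓ₆ θ.hd' θ.hL' θ.b₀ θ.b₁ Mstar, B9Thm312Whole.Ops (geo9Y x) (bg9YR (Matrix (Fin N) (Fin N) ℂ) (specialUnitaryUnits (Fin N)) R₁ R₂ x) (XBK (TrIdx N) x.toKIdx) (XBK (TrIdx N) x.toKIdx) (XHK (TrIdx N) x.toKIdx) (W12 x)) (H12 : MemberY θ.d₆ θ.ℓ₆ θ.hd' θ.hL' θ.b₀ θ.b₁ Mstar → Prop)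
    (bH13 : ∀ x : MemberY θ.d₆ θ.ℓ₆ θ.hd' θ.hL' θ.b₀ θ.b₁ Mstar, (bg9YR (Matrix (Fin N) (Fin N) ℂ) (specialUnitaryUnits (Fin N)) R₁ R₂ x).Cfg → BlockNorm (toB6 (geo9Y x) 1 (H12 x)) (W12 x → ℝ)) (θD12 r12 B12₀ δ12₀ δK12 σ12 ρ12 a12 M12 B12₃ δ12₃ ρ13 α12 κ13 : ℝ) (hθD12 : 0 ≤ θD12) (hr12 : 0 ≤ r12)
    -- row 20's Theorem-3.12 leaf in n06-l's PAIR-MB species (`thm312Printed_completePairMB`): NO displayed residual; extra numerics θ₂ B₂ ρ_f, the β-indexed step constant θH, the ε-indexed θI (print: B₀(β), B′₀(ε) pp. 397–398) and the majorant letters Bh Bi Bq Bi2 of (3.43)–(3.45)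
    (θ2₁₂ B12₂ ρf12 : ℝ) (θH12 Bh12 Bi12 Bq12 : ℝ → ℝ) (Bi2₁₂ : ℝ → ℝ → ℝ) (hθH12 : ∀ β, 0 ≤ β → β < 1 → 0 ≤ θH12 β) (hθ2₁₂ : 0 ≤ θ2₁₂) (hB12₂ : 0 ≤ B12₂) (hρf12 : 0 < ρf12) (hρf1 : ρf12 + σ12 ≤ (1 - α12) * ρ12)
    (hρf2 : ρf12 + 2 * σ12 + α12 * ρ12 ≤ ρ12) (hBh12 : ∀ β, 0 ≤ β → β < 1 → 0 ≤ Bh12 β) (hBi12 : ∀ ε, 0 < ε → ε ≤ 1 → 0 ≤ Bi12 ε) (hBi2₁₂ : ∀ ε β, 0 < ε → ε ≤ 1 → 0 ≤ β → β < 1 → 0 ≤ Bi2₁₂ ε β) (hBq12 : ∀ β, 0 ≤ Bq12 β)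
    (bHX12 : ∀ x : MemberY θ.d₆ θ.ℓ₆ θ.hd' θ.hL' θ.b₀ θ.b₁ Mstar, ℝ → BlockNorm (toB6 (geo9Y x) 1 (H12 x)) ((XBK (TrIdx N) x.toKIdx) → ℝ))
    (hB12₀ : 0 ≤ B12₀) (hB12₃ : 0 ≤ B12₃) (hσ12 : 0 < σ12) (hρ12 : 0 < ρ12) (hρS12 : ρ12 ≤ δ12₀) (hρδ12 : ρ12 + 2 * σ12 ≤ δK12) (hρ₃12 : ρ12 + σ12 ≤ δ12₃) (ha12 : 0 < a12) (hM12 : 0 < M12) (hα12 : 0 < α12) (hα12' : α12 ≤ 1 / 2)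
    (hκ13 : ∀ x U, (bH13 x U).κ ≤ κ13) (hρ13 : 0 < ρ13) (hρ13ρ : ρ13 + 5 * σ12 ≤ ρ12) (hσρ13 : 3 * σ12 < (1 - α12) * ρ13)
    -- row 21's Theorem-3.13 leaf in n06-l's PAIR-MB species (`thm313Printed_completePairMB`): NO displayed residual; extra numerics B₄ and the ε-indexed θ_V(ε), B_r(ε), the majorant letters
    -- B_hD B_x B_d B_d2 of (3.152)–(3.153)'s input members, the input norms `bHW13` on the H-carrier `W12`; the rate is (1 − α)ρ′ − 3σ (hence `hρ13ρ`'s 5σ and `hσρ13`)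
    (B13₄ : ℝ) (Br13 BhD13 Bx13 Bd13 : ℝ → ℝ) (Bd2₁₃ : ℝ → ℝ → ℝ) (hB13₄ : 0 ≤ B13₄) (hBr13 : ∀ ε, 0 < ε → 0 ≤ Br13 ε) (hBhD13 : ∀ β, 0 ≤ β → β < 1 → 0 ≤ BhD13 β) (hBx13 : ∀ β, 0 ≤ β → β < 1 → 0 ≤ Bx13 β)
    (hBd13 : ∀ ε, 0 < ε → ε ≤ 1 → 0 ≤ Bd13 ε) (hBd2₁₃ : ∀ ε β, 0 < ε → ε ≤ 1 → 0 ≤ β → β < 1 → 0 ≤ Bd2₁₃ ε β) (bHW13 : ∀ x : MemberY θ.d₆ θ.ℓ₆ θ.hd' θ.hL' θ.b₀ θ.b₁ Mstar, (bg9YR (Matrix (Fin N) (Fin N) ℂ) (specialUnitaryUnits (Fin N)) R₁ R₂ x).Cfg → ℝ → BlockNorm (toB6 (geo9Y x) 1 (H12 x)) (W12 x → ℝ)) (hκW13 : ∀ x U ε, (bHW13 x U ε).κ ≤ κ13)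
    -- the CUT species (n06-l g19 `B9Thm313WholeLettersCut`): the G′ letter of (3.152) and the free class of G₁∇*_U, per member
    (Gp : ∀ x : MemberY θ.d₆ θ.ℓ₆ θ.hd' θ.hL' θ.b₀ θ.b₁ Mstar, (bg9YR (Matrix (Fin N) (Fin N) ℂ) (specialUnitaryUnits (Fin N)) R₁ R₂ x).Cfg → Module.End ℝ (W12 x → ℝ))
    (bXH : ∀ x : MemberY θ.d₆ θ.ℓ₆ θ.hd' θ.hL' θ.b₀ θ.b₁ Mstar, (bg9YR (Matrix (Fin N) (Fin N) ℂ) (specialUnitaryUnits (Fin N)) R₁ R₂ x).Cfg → BlockNorm (toB6 (geo9Y x) 1 (H12 x)) (XBK (TrIdx N) x.toKIdx → ℝ)) (hκX : ∀ x U, (bXH x U).κ ≤ κ13)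
    (hmodel12 : ∀ x : MemberY θ.d₆ θ.ℓ₆ θ.hd' θ.hL' θ.b₀ θ.b₁ Mstar, M12 ≤ (geo9Y x).M → ∀ α₀ : ℝ, 0 < α₀ → (geo9Y x).M * α₀ ≤ a12 → ∀ U : (bg9YR (Matrix (Fin N) (Fin N) ℂ) (specialUnitaryUnits (Fin N)) R₁ R₂ x).Cfg, (bg9YR (Matrix (Fin N) (Fin N) ℂ) (specialUnitaryUnits (Fin N)) R₁ R₂ x).Reg335 c α₀ U →
      (bg9YR (Matrix (Fin N) (Fin N) ℂ) (specialUnitaryUnits (Fin N)) R₁ R₂ x).Reg336 c α₀ U → FormSmall (𝔬12 x) (r12 * ((geo9Y x).M * α₀)) U ∧ B9Thm312Whole.Identities (𝔬12 x) U)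
    (wZ : ∀ x : MemberY θ.d₆ θ.ℓ₆ θ.hd' θ.hL' θ.b₀ θ.b₁ Mstar, (geo9Y x).Site → ℝ) (hwZ : ∀ (x : MemberY θ.d₆ θ.ℓ₆ θ.hd' θ.hL' θ.b₀ θ.b₁ Mstar) (y : (geo9Y x).Site), 0 < wZ x y)
    (hlettersH12 : ∀ x : MemberY θ.d₆ θ.ℓ₆ θ.hd' θ.hL' θ.b₀ θ.b₁ Mstar, M12 ≤ (geo9Y x).M → ∀ α₀ : ℝ, 0 < α₀ → (geo9Y x).M * α₀ ≤ a12 → ∀ U : (bg9YR (Matrix (Fin N) (Fin N) ℂ) (specialUnitaryUnits (Fin N)) R₁ R₂ x).Cfg, (bg9YR (Matrix (Fin N) (Fin N) ℂ) (specialUnitaryUnits (Fin N)) R₁ R₂ x).Reg335 c α₀ U →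
      (bg9YR (Matrix (Fin N) (Fin N) ℂ) (specialUnitaryUnits (Fin N)) R₁ R₂ x).Reg336 c α₀ U → LettersHZ (𝔬12 x) 1 (H12 x) ⟨geo9Y_dist_triangle x, geo9Y_dist_comm x, geo9K_dist_nonneg x.toKIdx, geo9Y_len_pos x⟩ (weightNorm (BlockNorm.ofBlocks (toB6 (geo9Y x) 1 (H12 x)) (𝔬12 x).blkZ) (wZ x) (fun y => (hwZ x y).le)) B12₃ δ12₃ U)
    (hpinE : ∀ x : MemberY θ.d₆ θ.ℓ₆ θ.hd' θ.hL' θ.b₀ θ.b₁ Mstar, ((opsYNuOfRecordV4PE N θ Mstar 𝔯 𝔢 𝔴 𝔈) x).HasRWExp = HasRWExpOfOps (ops312RY (𝔬12 x)))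
    (hpinH : ∀ x : MemberY θ.d₆ θ.ℓ₆ θ.hd' θ.hL' θ.b₀ θ.b₁ Mstar, ((opsYNuOfRecordV4PE N θ Mstar 𝔯 𝔢 𝔴 𝔈) x).HasRWExpH = HasRWExpHOfOps (ops312RY (𝔬12 x)))
    (hpinK : ∀ x : MemberY θ.d₆ θ.ℓ₆ θ.hd' θ.hL' θ.b₀ θ.b₁ Mstar, ((opsYNuOfRecordV4PE N θ Mstar 𝔯 𝔢 𝔴 𝔈) x).PosDefK = PosDefKOfOps (ops312RY (𝔬12 x)))
    -- PINS of Theorems 3.12–3.13's walk letters to the coordinate models of the GENUINE `GD G₁ GG` — the nine `CoRealizesRel` and nine `CoReadsGlob` co-readings are theorems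
    (hblk12 : ∀ x : MemberY θ.d₆ θ.ℓ₆ θ.hd' θ.hL' θ.b₀ θ.b₁ Mstar, (𝔬12 x).blk = blkBK x.toKIdx (bI x)) (hblkY12 : ∀ x : MemberY θ.d₆ θ.ℓ₆ θ.hd' θ.hL' θ.b₀ θ.b₁ Mstar, (𝔬12 x).blkY = blkBK x.toKIdx (bI x))
    (hGco12 : ∀ (x : MemberY θ.d₆ θ.ℓ₆ θ.hd' θ.hL' θ.b₀ θ.b₁ Mstar) (U : (bg9YR (Matrix (Fin N) (Fin N) ℂ) (specialUnitaryUnits (Fin N)) R₁ R₂ x).Cfg), (𝔬12 x).G U = GcoK x.toKIdx (trBasis N) (bg9YR (Matrix (Fin N) (Fin N) ℂ) (specialUnitaryUnits (Fin N)) R₁ R₂ x) (fun U => U) (lettersYOfRecordV4P N θ Mstar 𝔯 x).GD U)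
    (hG1co12 : ∀ (x : MemberY θ.d₆ θ.ℓ₆ θ.hd' θ.hL' θ.b₀ θ.b₁ Mstar) (U : (bg9YR (Matrix (Fin N) (Fin N) ℂ) (specialUnitaryUnits (Fin N)) R₁ R₂ x).Cfg), (𝔬12 x).G1 U = GcoK x.toKIdx (trBasis N) (bg9YR (Matrix (Fin N) (Fin N) ℂ) (specialUnitaryUnits (Fin N)) R₁ R₂ x) (fun U => U) (lettersYOfRecordV4P N θ Mstar 𝔯 x).G₁ U)
    (hGGco12 : ∀ (x : MemberY θ.d₆ θ.ℓ₆ θ.hd' θ.hL' θ.b₀ θ.b₁ Mstar) (U : (bg9YR (Matrix (Fin N) (Fin N) ℂ) (specialUnitaryUnits (Fin N)) R₁ R₂ x).Cfg), (𝔬12 x).GG U = GcoK x.toKIdx (trBasis N) (bg9YR (Matrix (Fin N) (Fin N) ℂ) (specialUnitaryUnits (Fin N)) R₁ R₂ x) (fun U => U) (lettersYOfRecordV4P N θ Mstar 𝔯 x).GG U)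
    (hDco12 : ∀ (x : MemberY θ.d₆ θ.ℓ₆ θ.hd' θ.hL' θ.b₀ θ.b₁ Mstar) (U : (bg9YR (Matrix (Fin N) (Fin N) ℂ) (specialUnitaryUnits (Fin N)) R₁ R₂ x).Cfg), (𝔬12 x).D U = DcoK x.toKIdx (trBasis N) (bg9YR (Matrix (Fin N) (Fin N) ℂ) (specialUnitaryUnits (Fin N)) R₁ R₂ x) (fun U => U) U)
    (hDsco12 : ∀ (x : MemberY θ.d₆ θ.ℓ₆ θ.hd' θ.hL' θ.b₀ θ.b₁ Mstar) (U : (bg9YR (Matrix (Fin N) (Fin N) ℂ) (specialUnitaryUnits (Fin N)) R₁ R₂ x).Cfg), (𝔬12 x).Dstar U = DscoK x.toKIdx (trBasis N) (bg9YR (Matrix (Fin N) (Fin N) ℂ) (specialUnitaryUnits (Fin N)) R₁ R₂ x) (fun U => U) U)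
    (hblkZ12 : ∀ x : MemberY θ.d₆ θ.ℓ₆ θ.hd' θ.hL' θ.b₀ θ.b₁ Mstar, (𝔬12 x).blkZ = blkHK x.toKIdx)
    (hHm12 : ∀ (x : MemberY θ.d₆ θ.ℓ₆ θ.hd' θ.hL' θ.b₀ θ.b₁ Mstar) (U : (bg9YR (Matrix (Fin N) (Fin N) ℂ) (specialUnitaryUnits (Fin N)) R₁ R₂ x).Cfg), (𝔬12 x).Hm U = HcoK x.toKIdx (trBasis N) (bg9YR (Matrix (Fin N) (Fin N) ℂ) (specialUnitaryUnits (Fin N)) R₁ R₂ x) (fun U => U) (lettersYOfRecordV4P N θ Mstar 𝔯 x).H U)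
    (hH1m12 : ∀ (x : MemberY θ.d₆ θ.ℓ₆ θ.hd' θ.hL' θ.b₀ θ.b₁ Mstar) (U : (bg9YR (Matrix (Fin N) (Fin N) ℂ) (specialUnitaryUnits (Fin N)) R₁ R₂ x).Cfg), (𝔬12 x).H1m U = HcoK x.toKIdx (trBasis N) (bg9YR (Matrix (Fin N) (Fin N) ℂ) (specialUnitaryUnits (Fin N)) R₁ R₂ x) (fun U => U) (lettersYOfRecordV4P N θ Mstar 𝔯 x).H₁ U)
    -- row 20's Hölder ∕ input ∕ H-Hölder co-readings on the PAIR family through the bond-carrier probes `𝔭A` (one probe family per carrier), and Theorem 3.3 ∕ the perturbation step ∕ the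
    -- H-letters in n06-l's direction-indexed schemas at the pinned single-direction letters `Dd ∕ Dds` (printed-shape hypothesis schemas; nothing of print asserted)
    (hH1N : ∀ (x : MemberY θ.d₆ θ.ℓ₆ θ.hd' θ.hL' θ.b₀ θ.b₁ Mstar) (U : (bg9YR (Matrix (Fin N) (Fin N) ℂ) (specialUnitaryUnits (Fin N)) R₁ R₂ x).Cfg), H1ReadsNbr (kernelFamilyR R₁ R₂ ((opsYNuOfRecordV4PE N θ Mstar 𝔯 𝔢 𝔴 𝔈) x).GD) U (𝔭A x) (RelB x.toKIdx) 2 (𝔬12 x).blk (𝔬12 x).blkY (evBK x.toKIdx) (evBK x.toKIdx) ((𝔬12 x).D U ∘ₗ (𝔬12 x).G U) ((𝔬12 x).G U ∘ₗ (𝔬12 x).Dstar U) ∧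
      H1ReadsNbr (kernelFamilyR R₁ R₂ ((opsYNuOfRecordV4PE N θ Mstar 𝔯 𝔢 𝔴 𝔈) x).G₁) U (𝔭A x) (RelB x.toKIdx) 2 (𝔬12 x).blk (𝔬12 x).blkY (evBK x.toKIdx) (evBK x.toKIdx) ((𝔬12 x).D U ∘ₗ (𝔬12 x).G1 U) ((𝔬12 x).G1 U ∘ₗ (𝔬12 x).Dstar U) ∧
      H1ReadsNbr (kernelFamilyR R₁ R₂ ((opsYNuOfRecordV4PE N θ Mstar 𝔯 𝔢 𝔴 𝔈) x).GG) U (𝔭A x) (RelB x.toKIdx) 2 (𝔬12 x).blk (𝔬12 x).blkY (evBK x.toKIdx) (evBK x.toKIdx) ((𝔬12 x).D U ∘ₗ (𝔬12 x).GG U) ((𝔬12 x).GG U ∘ₗ (𝔬12 x).Dstar U))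
    (hIF : ∀ (x : MemberY θ.d₆ θ.ℓ₆ θ.hd' θ.hL' θ.b₀ θ.b₁ Mstar) (U : (bg9YR (Matrix (Fin N) (Fin N) ℂ) (specialUnitaryUnits (Fin N)) R₁ R₂ x).Cfg), InputReadsFam (kernelFamilyR R₁ R₂ ((opsYNuOfRecordV4PE N θ Mstar 𝔯 𝔢 𝔴 𝔈) x).GD) U (bHX12 x) 2 ((𝔬12 x).blk ∘ Prod.fst) ((𝔭A x).blkPX ∘ Prod.fst) (fun β => sliceProbe ((𝔭A x).ΦX U β)) (evBK x.toKIdx) (familyOp fun q : Fin (θ.d₆ + 1) × Fin (θ.d₆ + 1) => (Dd x) U q.1 ∘ₗ ((𝔬12 x).G U ∘ₗ (Dds x) U q.2)) ∧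
      InputReadsFam (kernelFamilyR R₁ R₂ ((opsYNuOfRecordV4PE N θ Mstar 𝔯 𝔢 𝔴 𝔈) x).G₁) U (bHX12 x) 2 ((𝔬12 x).blk ∘ Prod.fst) ((𝔭A x).blkPX ∘ Prod.fst) (fun β => sliceProbe ((𝔭A x).ΦX U β)) (evBK x.toKIdx) (familyOp fun q : Fin (θ.d₆ + 1) × Fin (θ.d₆ + 1) => (Dd x) U q.1 ∘ₗ ((𝔬12 x).G1 U ∘ₗ (Dds x) U q.2)) ∧
      InputReadsFam (kernelFamilyR R₁ R₂ ((opsYNuOfRecordV4PE N θ Mstar 𝔯 𝔢 𝔴 𝔈) x).GG) U (bHX12 x) 2 ((𝔬12 x).blk ∘ Prod.fst) ((𝔭A x).blkPX ∘ Prod.fst) (fun β => sliceProbe ((𝔭A x).ΦX U β)) (evBK x.toKIdx) (familyOp fun q : Fin (θ.d₆ + 1) × Fin (θ.d₆ + 1) => (Dd x) U q.1 ∘ₗ ((𝔬12 x).GG U ∘ₗ (Dds x) U q.2)))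
    (hHCN : ∀ (x : MemberY θ.d₆ θ.ℓ₆ θ.hd' θ.hL' θ.b₀ θ.b₁ Mstar) (U : (bg9YR (Matrix (Fin N) (Fin N) ℂ) (specialUnitaryUnits (Fin N)) R₁ R₂ x).Cfg), CoReadsHHolderNbr (hKernelR R₁ R₂ ((opsYNuOfRecordV4PE N θ Mstar 𝔯 𝔢 𝔴 𝔈) x).H) U (θ.d₆ + 1) (𝔭A x) 2 (𝔬12 x).blkZ ((𝔬12 x).D U ∘ₗ (𝔬12 x).Hm U) ∧ CoReadsHHolderNbr (hKernelR R₁ R₂ ((opsYNuOfRecordV4PE N θ Mstar 𝔯 𝔢 𝔴 𝔈) x).H₁) U (θ.d₆ + 1) (𝔭A x) 2 (𝔬12 x).blkZ ((𝔬12 x).D U ∘ₗ (𝔬12 x).H1m U))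
    (hsymD : ∀ (x : MemberY θ.d₆ θ.ℓ₆ θ.hd' θ.hL' θ.b₀ θ.b₁ Mstar) (U : (bg9YR (Matrix (Fin N) (Fin N) ℂ) (specialUnitaryUnits (Fin N)) R₁ R₂ x).Cfg), (∀ μ z, U μ z ∈ specialUnitaryUnits (Fin N)) → IsSymmTr (fun _ => (1 : ℝ)) ((lettersYOfRecordV4P N θ Mstar 𝔯 x).GD U) ∧ IsSymmTr (fun _ => (1 : ℝ)) ((lettersYOfRecordV4P N θ Mstar 𝔯 x).G₁ U) ∧ IsSymmTr (fun _ => (1 : ℝ)) ((lettersYOfRecordV4P N θ Mstar 𝔯 x).GG U))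
    (hG0C : ∀ x : MemberY θ.d₆ θ.ℓ₆ θ.hd' θ.hL' θ.b₀ θ.b₁ Mstar, M12 ≤ (geo9Y x).M → ∀ α₀ : ℝ, 0 < α₀ → (geo9Y x).M * α₀ ≤ a12 → ∀ U : (bg9YR (Matrix (Fin N) (Fin N) ℂ) (specialUnitaryUnits (Fin N)) R₁ R₂ x).Cfg, (bg9YR (Matrix (Fin N) (Fin N) ℂ) (specialUnitaryUnits (Fin N)) R₁ R₂ x).Reg335 c α₀ U →
      (bg9YR (Matrix (Fin N) (Fin N) ℂ) (specialUnitaryUnits (Fin N)) R₁ R₂ x).Reg336 c α₀ U →  Thm33G0Dir (𝔬12 x) (𝔭A x) (Dd x) (Dds x) 1 (H12 x) (bHX12 x) B12₀ Bh12 Bi12 Bi2₁₂ δ12₀ U ∧ Thm33G0DirR (𝔬12 x) (Dds x) 1 (H12 x) B12₀ δ12₀ U ∧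
      Thm33G0L2M (𝔬12 x) (Dd x) (Dds x) 1 (H12 x) B12₂ δ12₀ U)
    (hStL : ∀ x : MemberY θ.d₆ θ.ℓ₆ θ.hd' θ.hL' θ.b₀ θ.b₁ Mstar, M12 ≤ (geo9Y x).M → ∀ α₀ : ℝ, 0 < α₀ → (geo9Y x).M * α₀ ≤ a12 → ∀ U : (bg9YR (Matrix (Fin N) (Fin N) ℂ) (specialUnitaryUnits (Fin N)) R₁ R₂ x).Cfg, (bg9YR (Matrix (Fin N) (Fin N) ℂ) (specialUnitaryUnits (Fin N)) R₁ R₂ x).Reg335 c α₀ U →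
      (bg9YR (Matrix (Fin N) (Fin N) ℂ) (specialUnitaryUnits (Fin N)) R₁ R₂ x).Reg336 c α₀ U →
  StepL2 (𝔬12 x) 1 (H12 x) (θ2₁₂ * ((geo9Y x).M * α₀)) δK12 U)
    (hLHH : ∀ x : MemberY θ.d₆ θ.ℓ₆ θ.hd' θ.hL' θ.b₀ θ.b₁ Mstar, M12 ≤ (geo9Y x).M → ∀ α₀ : ℝ, 0 < α₀ → (geo9Y x).M * α₀ ≤ a12 → ∀ U : (bg9YR (Matrix (Fin N) (Fin N) ℂ) (specialUnitaryUnits (Fin N)) R₁ R₂ x).Cfg, (bg9YR (Matrix (Fin N) (Fin N) ℂ) (specialUnitaryUnits (Fin N)) R₁ R₂ x).Reg335 c α₀ U →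
      (bg9YR (Matrix (Fin N) (Fin N) ℂ) (specialUnitaryUnits (Fin N)) R₁ R₂ x).Reg336 c α₀ U →  LettersHHZ (𝔬12 x) (𝔭A x) 1 (H12 x) (fun y => (geo9Y_len_pos x y).le) (weightNorm (BlockNorm.ofBlocks (toB6 (geo9Y x) 1 (H12 x)) (𝔬12 x).blkZ) (wZ x) (fun y => (hwZ x y).le)) Bq12 δ12₃ U)
    (hLH3 : ∀ x : MemberY θ.d₆ θ.ℓ₆ θ.hd' θ.hL' θ.b₀ θ.b₁ Mstar, M12 ≤ (geo9Y x).M → ∀ α₀ : ℝ, 0 < α₀ → (geo9Y x).M * α₀ ≤ a12 → ∀ U : (bg9YR (Matrix (Fin N) (Fin N) ℂ) (specialUnitaryUnits (Fin N)) R₁ R₂ x).Cfg, (bg9YR (Matrix (Fin N) (Fin N) ℂ) (specialUnitaryUnits (Fin N)) R₁ R₂ x).Reg335 c α₀ U →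
      (bg9YR (Matrix (Fin N) (Fin N) ℂ) (specialUnitaryUnits (Fin N)) R₁ R₂ x).Reg336 c α₀ U → Letters313HZc (𝔬12 x) (𝔭A x) (Gp x) 1 (H12 x) ⟨geo9Y_dist_triangle x, geo9Y_dist_comm x, geo9K_dist_nonneg x.toKIdx, geo9Y_len_pos x⟩ (wZ x) (hwZ x) (bH13 x U) BhD13 Bx13 δ12₃ (bXH x U) U)
    (vZ : ∀ x : MemberY θ.d₆ θ.ℓ₆ θ.hd' θ.hL' θ.b₀ θ.b₁ Mstar, (geo9Y x).Site → ℝ) (hvZ : ∀ (x : MemberY θ.d₆ θ.ℓ₆ θ.hd' θ.hL' θ.b₀ θ.b₁ Mstar) (y : (geo9Y x).Site), 0 < vZ x y)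
    (hLL2 : ∀ x : MemberY θ.d₆ θ.ℓ₆ θ.hd' θ.hL' θ.b₀ θ.b₁ Mstar, M12 ≤ (geo9Y x).M → ∀ α₀ : ℝ, 0 < α₀ → (geo9Y x).M * α₀ ≤ a12 → ∀ U : (bg9YR (Matrix (Fin N) (Fin N) ℂ) (specialUnitaryUnits (Fin N)) R₁ R₂ x).Cfg, (bg9YR (Matrix (Fin N) (Fin N) ℂ) (specialUnitaryUnits (Fin N)) R₁ R₂ x).Reg335 c α₀ U →
      (bg9YR (Matrix (Fin N) (Fin N) ℂ) (specialUnitaryUnits (Fin N)) R₁ R₂ x).Reg336 c α₀ U → Letters313L2Pc (𝔬12 x) (Dd x) (Dds x) 1 (H12 x) B13₄ δ12₃ (vZ x) (hvZ x) U ∧ Letters313L2MZ (𝔬12 x) (Dd x) (Dds x) 1 (H12 x) B13₄ δ12₃ (vZ x) (hvZ x) U)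
    -- the (3.152)–(3.153) input letters FIELD-WISE (dag-n06-l P-U8S″: no `Letters313IMBC` record, hence no right form `tDv` and no θ_V letter)
    (hrgdd13 : ∀ x : MemberY θ.d₆ θ.ℓ₆ θ.hd' θ.hL' θ.b₀ θ.b₁ Mstar, M12 ≤ (geo9Y x).M → ∀ α₀ : ℝ, 0 < α₀ → (geo9Y x).M * α₀ ≤ a12 → ∀ U : (bg9YR (Matrix (Fin N) (Fin N) ℂ) (specialUnitaryUnits (Fin N)) R₁ R₂ x).Cfg, (bg9YR (Matrix (Fin N) (Fin N) ℂ) (specialUnitaryUnits (Fin N)) R₁ R₂ x).Reg335 c α₀ U →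
      (bg9YR (Matrix (Fin N) (Fin N) ℂ) (specialUnitaryUnits (Fin N)) R₁ R₂ x).Reg336 c α₀ U →
        ∀ (μ : Fin (θ.d₆ + 1)) (ε : ℝ), 0 < ε → HasMaj (bHX12 x ε) (bHW13 x U ε) ((𝔬12 x).R U ∘ₗ (𝔬12 x).Dvstar U ∘ₗ (𝔬12 x).G1 U ∘ₗ Dds x U μ)
          (fun a b => Br13 ε * Real.exp (-(δ12₃ * (geo9Y x).dist a b))))
    (hdgDvd13 : ∀ x : MemberY θ.d₆ θ.ℓ₆ θ.hd' θ.hL' θ.b₀ θ.b₁ Mstar, M12 ≤ (geo9Y x).M → ∀ α₀ : ℝ, 0 < α₀ → (geo9Y x).M * α₀ ≤ a12 → ∀ U : (bg9YR (Matrix (Fin N) (Fin N) ℂ) (specialUnitaryUnits (Fin N)) R₁ R₂ x).Cfg, (bg9YR (Matrix (Fin N) (Fin N) ℂ) (specialUnitaryUnits (Fin N)) R₁ R₂ x).Reg335 c α₀ U →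
      (bg9YR (Matrix (Fin N) (Fin N) ℂ) (specialUnitaryUnits (Fin N)) R₁ R₂ x).Reg336 c α₀ U →
        ∀ (ν : Fin (θ.d₆ + 1)) (ε : ℝ), 0 < ε → ε ≤ 1 → HasMaj (bHW13 x U ε) (BlockNorm.ofBlocks (toB6 (geo9Y x) 1 (H12 x)) (𝔬12 x).blk)
          (Dd x U ν ∘ₗ ((𝔬12 x).G0 U ∘ₗ (𝔬12 x).Dv U)) (fun (a b : (geo9Y x).Site) => Bd13 ε * Real.exp (-(δ12₃ * (geo9Y x).dist a b))))
    (hpdgDvd13 : ∀ x : MemberY θ.d₆ θ.ℓ₆ θ.hd' θ.hL' θ.b₀ θ.b₁ Mstar, M12 ≤ (geo9Y x).M → ∀ α₀ : ℝ, 0 < α₀ → (geo9Y x).M * α₀ ≤ a12 → ∀ U : (bg9YR (Matrix (Fin N) (Fin N) ℂ) (specialUnitaryUnits (Fin N)) R₁ R₂ x).Cfg, (bg9YR (Matrix (Fin N) (Fin N) ℂ) (specialUnitaryUnits (Fin N)) R₁ R₂ x).Reg335 c α₀ U →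
      (bg9YR (Matrix (Fin N) (Fin N) ℂ) (specialUnitaryUnits (Fin N)) R₁ R₂ x).Reg336 c α₀ U →
        ∀ (ν : Fin (θ.d₆ + 1)) (ε β : ℝ), 0 < ε → ε ≤ 1 → 0 ≤ β → β < 1 →
          HasMaj (bHW13 x U (β + ε)) (BlockNorm.ofBlocks (toB6 (geo9Y x) 1 (H12 x)) (𝔭A x).blkPX)
            (((𝔭A x).ΦX U β ∘ₗ Dd x U ν) ∘ₗ ((𝔬12 x).G0 U ∘ₗ (𝔬12 x).Dv U))
            (fun (a b : (geo9Y x).Site) => Bd2₁₃ ε β * (geo9Y x).len a ^ (-β) * Real.exp (-(δ12₃ * (geo9Y x).dist a b))))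
    -- the EIGHT bXH-free Z-letters FIELD-WISE (the certificate's display `hZ8` VERBATIM) and the derived (3.44) member `wGp` (dag-n06-l `…N06WGpLegAtPinsPhysPU.hwGp_of_pinsP_geo9Y`);
    -- `gXH` (G₁∇\*_U INTO bXH) is derived INSIDE the row-21 S-leaf `…MBCZcUSX` from `hst11` — no `Letters313Zc` binder, no leg (dag-n06-l (R3))
    (hZ7 : ∀ x : MemberY θ.d₆ θ.ℓ₆ θ.hd' θ.hL' θ.b₀ θ.b₁ Mstar, M12 ≤ (geo9Y x).M → ∀ α₀ : ℝ, 0 < α₀ → (geo9Y x).M * α₀ ≤ a12 → ∀ U : (bg9YR (Matrix (Fin N) (Fin N) ℂ) (specialUnitaryUnits (Fin N)) R₁ R₂ x).Cfg, (bg9YR (Matrix (Fin N) (Fin N) ℂ) (specialUnitaryUnits (Fin N)) R₁ R₂ x).Reg335 c α₀ U →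
      (bg9YR (Matrix (Fin N) (Fin N) ℂ) (specialUnitaryUnits (Fin N)) R₁ R₂ x).Reg336 c α₀ U →
        HasMaj (cNorm 1 (H12 x) (𝔬12 x).blkW (fun y => (geo9Y_len_pos x y).le) 1) (cNorm 1 (H12 x) (𝔬12 x).blk (fun y => (geo9Y_len_pos x y).le) 2) ((𝔬12 x).G0 U ∘ₗ (𝔬12 x).Dv U) (fun a b => B12₃ * Real.exp (-(δ12₃ * (geo9Y x).dist a b))) ∧
        HasMaj (weightNorm (BlockNorm.ofBlocks (toB6 (geo9Y x) 1 (H12 x)) (𝔬12 x).blkZ) (wZ x) fun y => (hwZ x y).le) (cNorm 1 (H12 x) (𝔬12 x).blk (fun y => (geo9Y_len_pos x y).le) 2) ((𝔬12 x).G0 U ∘ₗ (𝔬12 x).Qstar U) (fun a b => B12₃ * Real.exp (-(δ12₃ * (geo9Y x).dist a b))) ∧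
        HasMaj (weightNorm (BlockNorm.ofBlocks (toB6 (geo9Y x) 1 (H12 x)) (𝔬12 x).blkZ) (fun y => (geo9Y x).len y * wZ x y) fun y => (mul_pos (geo9Y_len_pos x y) (hwZ x y)).le) (cNorm 1 (H12 x) (𝔬12 x).blk (fun y => (geo9Y_len_pos x y).le) 1) ((𝔬12 x).G0 U ∘ₗ (𝔬12 x).Qstar U) (fun a b => B12₃ * Real.exp (-(δ12₃ * (geo9Y x).dist a b))) ∧
        HasMaj (cNorm 1 (H12 x) (𝔬12 x).blkZ (fun y => (geo9Y_len_pos x y).le) 2) (weightNorm (BlockNorm.ofBlocks (toB6 (geo9Y x) 1 (H12 x)) (𝔬12 x).blkZ) (wZ x) fun y => (hwZ x y).le) ((𝔬12 x).C1 U) (fun a b => B12₃ * Real.exp (-(δ12₃ * (geo9Y x).dist a b))) ∧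
        HasMaj (cNorm 1 (H12 x) (𝔬12 x).blkZ (fun y => (geo9Y_len_pos x y).le) 1) (weightNorm (BlockNorm.ofBlocks (toB6 (geo9Y x) 1 (H12 x)) (𝔬12 x).blkZ) (fun y => (geo9Y x).len y * wZ x y) fun y => (mul_pos (geo9Y_len_pos x y) (hwZ x y)).le) ((𝔬12 x).C1 U) (fun a b => B12₃ * Real.exp (-(δ12₃ * (geo9Y x).dist a b))) ∧
        HasMaj (cNorm 1 (H12 x) (𝔬12 x).blk (fun y => (geo9Y_len_pos x y).le) 2) (cNorm 1 (H12 x) (𝔬12 x).blkZ (fun y => (geo9Y_len_pos x y).le) 2) ((𝔬12 x).Q U) (fun a b => B12₃ * Real.exp (-(δ12₃ * (geo9Y x).dist a b))) ∧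
        HasMaj (cNorm 1 (H12 x) (𝔬12 x).blk (fun y => (geo9Y_len_pos x y).le) 1) (cNorm 1 (H12 x) (𝔬12 x).blkZ (fun y => (geo9Y_len_pos x y).le) 1) ((𝔬12 x).Q U) (fun a b => B12₃ * Real.exp (-(δ12₃ * (geo9Y x).dist a b))))
    -- the letter `rgd2` (R∇\*_UG₁ : 𝔠⁽⁰⁾ → 𝔠_W⁽¹⁾) DERIVED by the certificate (dag-n06-l `…N06Rgd2LegAtPinsPhysPU.hrgd2_of_pinsP_geo9Y` + its own `Ids3152`), no longer displayed
    (hrgd2_13 : ∀ x : MemberY θ.d₆ θ.ℓ₆ θ.hd' θ.hL' θ.b₀ θ.b₁ Mstar, M12 ≤ (geo9Y x).M → ∀ α₀ : ℝ, 0 < α₀ → (geo9Y x).M * α₀ ≤ a12 → ∀ U : (bg9YR (Matrix (Fin N) (Fin N) ℂ) (specialUnitaryUnits (Fin N)) R₁ R₂ x).Cfg, (bg9YR (Matrix (Fin N) (Fin N) ℂ) (specialUnitaryUnits (Fin N)) R₁ R₂ x).Reg335 c α₀ U →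
      (bg9YR (Matrix (Fin N) (Fin N) ℂ) (specialUnitaryUnits (Fin N)) R₁ R₂ x).Reg336 c α₀ U →
        HasMaj (cNorm 1 (H12 x) (𝔬12 x).blk (fun y => (geo9Y_len_pos x y).le) 0) (cNorm 1 (H12 x) (𝔬12 x).blkW (fun y => (geo9Y_len_pos x y).le) 1) ((𝔬12 x).R U ∘ₗ (𝔬12 x).Dvstar U ∘ₗ (𝔬12 x).G1 U ∘ₗ LinearMap.id) (fun a b => B12₃ * Real.exp (-(δ12₃ * (geo9Y x).dist a b))))
    (hwGp13 : ∀ x : MemberY θ.d₆ θ.ℓ₆ θ.hd' θ.hL' θ.b₀ θ.b₁ Mstar, M12 ≤ (geo9Y x).M → ∀ α₀ : ℝ, 0 < α₀ → (geo9Y x).M * α₀ ≤ a12 → ∀ U : (bg9YR (Matrix (Fin N) (Fin N) ℂ) (specialUnitaryUnits (Fin N)) R₁ R₂ x).Cfg, (bg9YR (Matrix (Fin N) (Fin N) ℂ) (specialUnitaryUnits (Fin N)) R₁ R₂ x).Reg335 c α₀ U →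
      (bg9YR (Matrix (Fin N) (Fin N) ℂ) (specialUnitaryUnits (Fin N)) R₁ R₂ x).Reg336 c α₀ U →
        HasMaj (bXH x U) (cNorm 1 (H12 x) (𝔬12 x).blk (fun y => (geo9Y_len_pos x y).le) 1) ((𝔬12 x).Dv U ∘ₗ Gp x U ∘ₗ (𝔬12 x).R U ∘ₗ (𝔬12 x).Dvstar U) (fun a b => B12₃ * Real.exp (-(δ12₃ * (geo9Y x).dist a b))))
    (h152 : ∀ x : MemberY θ.d₆ θ.ℓ₆ θ.hd' θ.hL' θ.b₀ θ.b₁ Mstar, M12 ≤ (geo9Y x).M → ∀ α₀ : ℝ, 0 < α₀ → (geo9Y x).M * α₀ ≤ a12 → ∀ U : (bg9YR (Matrix (Fin N) (Fin N) ℂ) (specialUnitaryUnits (Fin N)) R₁ R₂ x).Cfg, (bg9YR (Matrix (Fin N) (Fin N) ℂ) (specialUnitaryUnits (Fin N)) R₁ R₂ x).Reg335 c α₀ U →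
      (bg9YR (Matrix (Fin N) (Fin N) ℂ) (specialUnitaryUnits (Fin N)) R₁ R₂ x).Reg336 c α₀ U → Ids3152 (𝔬12 x) (Gp x) U)
    (hlettersD13 : ∀ x : MemberY θ.d₆ θ.ℓ₆ θ.hd' θ.hL' θ.b₀ θ.b₁ Mstar, M12 ≤ (geo9Y x).M → ∀ α₀ : ℝ, 0 < α₀ → (geo9Y x).M * α₀ ≤ a12 → ∀ U : (bg9YR (Matrix (Fin N) (Fin N) ℂ) (specialUnitaryUnits (Fin N)) R₁ R₂ x).Cfg, (bg9YR (Matrix (Fin N) (Fin N) ℂ) (specialUnitaryUnits (Fin N)) R₁ R₂ x).Reg335 c α₀ U →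
      (bg9YR (Matrix (Fin N) (Fin N) ℂ) (specialUnitaryUnits (Fin N)) R₁ R₂ x).Reg336 c α₀ U → Letters313DZ (𝔬12 x) 1 (H12 x) ⟨geo9Y_dist_triangle x, geo9Y_dist_comm x, geo9K_dist_nonneg x.toKIdx, geo9Y_len_pos x⟩ (wZ x) (hwZ x) B12₃ δ12₃ (bH13 x U) U ∧
        Letters313DMZ (𝔬12 x) (𝔭A x) (Dd x) 1 (H12 x) ⟨geo9Y_dist_triangle x, geo9Y_dist_comm x, geo9K_dist_nonneg x.toKIdx, geo9Y_len_pos x⟩ (wZ x) (hwZ x) B12₃ Bq12 δ12₃ (bH13 x U) U)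
    -- U8 (director-ym №272 (5)): the regular state classes' letters, the (3.43) homogeneous majorant, the ℓ¹ input controls (№285 (R-b)) and the four STATE TUPLES replacing the raw Δ⁽²⁾ letters
    (θS κS A₀S AW AQ AD AQ1 CR δP : ℝ) (AI AV : ℝ → ℝ) (hθS : 0 ≤ θS) (hκS : 1 ≤ κS) (hκ13S : κ13 ≤ κS) (hA₀S : 0 ≤ A₀S) (hAW : 0 ≤ AW) (hAQ : 0 ≤ AQ) (hAD : 0 ≤ AD) (hADB12 : 2 * AD ≤ B12₃) (hAQ1 : 0 ≤ AQ1) (hCR : 0 ≤ CR)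
    (hAI : ∀ ε, 0 < ε → 0 ≤ AI ε) (hAV : ∀ ε, 0 < ε → 0 ≤ AV ε) (hρP12 : ρ12 + 2 * σ12 ≤ δP) (hδP₀ : δP ≤ δ12₀) (hδP₃ : δP ≤ δ12₃)
    (he1 : ∀ x : MemberY θ.d₆ θ.ℓ₆ θ.hd' θ.hL' θ.b₀ θ.b₁ Mstar, M12 ≤ (geo9Y x).M → ∀ α₀ : ℝ, 0 < α₀ → (geo9Y x).M * α₀ ≤ a12 → ∀ U : (bg9YR (Matrix (Fin N) (Fin N) ℂ) (specialUnitaryUnits (Fin N)) R₁ R₂ x).Cfg, (bg9YR (Matrix (Fin N) (Fin N) ℂ) (specialUnitaryUnits (Fin N)) R₁ R₂ x).Reg335 c α₀ U →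
      (bg9YR (Matrix (Fin N) (Fin N) ℂ) (specialUnitaryUnits (Fin N)) R₁ R₂ x).Reg336 c α₀ U →
  HasMajorantHom (g := toB6 (geo9Y x) 1 (H12 x)) (𝔬12 x).blk (𝔬12 x).blkY ((𝔬12 x).D U ∘ₗ (𝔬12 x).G0 U)
          (fun (a b : (geo9Y x).Site) => B12₀ * (geo9Y x).len a * Real.exp (-(δ12₀ * (geo9Y x).dist a b))))
    (hdomX : ∀ (x : MemberY θ.d₆ θ.ℓ₆ θ.hd' θ.hL' θ.b₀ θ.b₁ Mstar) (ε : ℝ), 0 < ε → ∃ ΛX : ℝ, 0 ≤ ΛX ∧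
      ∀ (y : (geo9Y x).Site) (μ : XBK (TrIdx N) x.toKIdx → ℝ), (bHX12 x ε).IsLoc y μ → ∑ q : XBK (TrIdx N) x.toKIdx, |μ q| ≤ ΛX * (bHX12 x ε).loc y μ)
    (hdomW : ∀ (x : MemberY θ.d₆ θ.ℓ₆ θ.hd' θ.hL' θ.b₀ θ.b₁ Mstar) (U : (bg9YR (Matrix (Fin N) (Fin N) ℂ) (specialUnitaryUnits (Fin N)) R₁ R₂ x).Cfg) (ε : ℝ), 0 < ε → ∃ ΛW : ℝ, 0 ≤ ΛW ∧
      ∀ (y : (geo9Y x).Site) (μ : W12 x → ℝ), (bHW13 x U ε).IsLoc y μ → ∑ w : W12 x, |μ w| ≤ ΛW * (bHW13 x U ε).loc y μ)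
    (hst20 : ∀ x : MemberY θ.d₆ θ.ℓ₆ θ.hd' θ.hL' θ.b₀ θ.b₁ Mstar, M12 ≤ (geo9Y x).M → ∀ α₀ : ℝ, 0 < α₀ → (geo9Y x).M * α₀ ≤ a12 → ∀ U : (bg9YR (Matrix (Fin N) (Fin N) ℂ) (specialUnitaryUnits (Fin N)) R₁ R₂ x).Cfg, (bg9YR (Matrix (Fin N) (Fin N) ℂ) (specialUnitaryUnits (Fin N)) R₁ R₂ x).Reg335 c α₀ U →
      (bg9YR (Matrix (Fin N) (Fin N) ℂ) (specialUnitaryUnits (Fin N)) R₁ R₂ x).Reg336 c α₀ U →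
        (StepS (𝔬12 x) (weightNorm (bXH x U) (rwt (geo9Y x) (-1)) (rwt_nonneg (fun y => (geo9Y_len_pos x y).le) (-1))) (θS * ((geo9Y x).M * α₀)) δK12 U ∧
          (HasMaj (weightNorm (bXH x U) (rwt (geo9Y x) (-1)) (rwt_nonneg (fun y => (geo9Y_len_pos x y).le) (-1))) (cNorm 1 (H12 x) (𝔬12 x).blkY (fun y => (geo9Y_len_pos x y).le) 1) ((𝔬12 x).D U ∘ₗ (𝔬12 x).G0 U ∘ₗ (𝔬12 x).Tpi U) (fun a b => θD12 * ((geo9Y x).M * α₀) * Real.exp (-(δK12 * (geo9Y x).dist a b))) ∧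
            HasMaj (weightNorm (bXH x U) (rwt (geo9Y x) (-1)) (rwt_nonneg (fun y => (geo9Y_len_pos x y).le) (-1))) (cNorm 1 (H12 x) (𝔬12 x).blkY (fun y => (geo9Y_len_pos x y).le) 1) ((𝔬12 x).D U ∘ₗ (𝔬12 x).G0 U ∘ₗ ((𝔬12 x).Tpi U + (𝔬12 x).T2 U)) (fun a b => θD12 * ((geo9Y x).M * α₀) * Real.exp (-(δK12 * (geo9Y x).dist a b)))) ∧
          (∀ β : ℝ, 0 ≤ β → β < 1 →
            HasMaj (weightNorm (bXH x U) (rwt (geo9Y x) (-1)) (rwt_nonneg (fun y => (geo9Y_len_pos x y).le) (-1))) (cNormR 1 (H12 x) (𝔭A x).blkPY (fun y => (geo9Y_len_pos x y).le) (β - 1)) (((𝔭A x).ΦY U β ∘ₗ (𝔬12 x).D U ∘ₗ (𝔬12 x).G0 U) ∘ₗ (𝔬12 x).Tpi U) (fun a b => θH12 β * ((geo9Y x).M * α₀) * Real.exp (-(δK12 * (geo9Y x).dist a b))) ∧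
            HasMaj (weightNorm (bXH x U) (rwt (geo9Y x) (-1)) (rwt_nonneg (fun y => (geo9Y_len_pos x y).le) (-1))) (cNormR 1 (H12 x) (𝔭A x).blkPY (fun y => (geo9Y_len_pos x y).le) (β - 1)) (((𝔭A x).ΦY U β ∘ₗ (𝔬12 x).D U ∘ₗ (𝔬12 x).G0 U) ∘ₗ ((𝔬12 x).Tpi U + (𝔬12 x).T2 U)) (fun a b => θH12 β * ((geo9Y x).M * α₀) * Real.exp (-(δK12 * (geo9Y x).dist a b)))) ∧
          HasMaj (cNorm 1 (H12 x) (𝔬12 x).blk (fun y => (geo9Y_len_pos x y).le) 0) (weightNorm (bXH x U) (rwt (geo9Y x) (-1)) (rwt_nonneg (fun y => (geo9Y_len_pos x y).le) (-1))) ((𝔬12 x).G0 U) (fun a b => A₀S * Real.exp (-(δP * (geo9Y x).dist a b))) ∧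
          HasMaj (weightNorm (BlockNorm.ofBlocks (toB6 (geo9Y x) 1 (H12 x)) (𝔬12 x).blkZ) (wZ x) (fun y => (hwZ x y).le)) (weightNorm (bXH x U) (rwt (geo9Y x) (-1)) (rwt_nonneg (fun y => (geo9Y_len_pos x y).le) (-1))) ((𝔬12 x).G0 U ∘ₗ (𝔬12 x).Qstar U) (fun a b => AQ * Real.exp (-(δP * (geo9Y x).dist a b))) ∧
          HasMaj (weightNorm (bXH x U) (rwt (geo9Y x) (-1)) (rwt_nonneg (fun y => (geo9Y_len_pos x y).le) (-1))) (cNormR 1 (H12 x) (𝔬12 x).blk (fun y => (geo9Y_len_pos x y).le) (-2)) LinearMap.id (fun a b => CR * Real.exp (-(δP * (geo9Y x).dist a b))) ∧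
          (weightNorm (bXH x U) (rwt (geo9Y x) (-1)) (rwt_nonneg (fun y => (geo9Y_len_pos x y).le) (-1))).κ ≤ κS ∧
          (∃ Λ : ℝ, 0 ≤ Λ ∧ ∀ (y : (geo9Y x).Site) (F : XBK (TrIdx N) x.toKIdx → ℝ), (weightNorm (bXH x U) (rwt (geo9Y x) (-1)) (rwt_nonneg (fun y => (geo9Y_len_pos x y).le) (-1))).loc y F ≤ Λ * ∑ q : XBK (TrIdx N) x.toKIdx, |F q|)))
    (hst10 : ∀ x : MemberY θ.d₆ θ.ℓ₆ θ.hd' θ.hL' θ.b₀ θ.b₁ Mstar, M12 ≤ (geo9Y x).M → ∀ α₀ : ℝ, 0 < α₀ → (geo9Y x).M * α₀ ≤ a12 → ∀ U : (bg9YR (Matrix (Fin N) (Fin N) ℂ) (specialUnitaryUnits (Fin N)) R₁ R₂ x).Cfg, (bg9YR (Matrix (Fin N) (Fin N) ℂ) (specialUnitaryUnits (Fin N)) R₁ R₂ x).Reg335 c α₀ U →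
      (bg9YR (Matrix (Fin N) (Fin N) ℂ) (specialUnitaryUnits (Fin N)) R₁ R₂ x).Reg336 c α₀ U →
        (StepS (𝔬12 x) (bXH x U) (θS * ((geo9Y x).M * α₀)) δK12 U ∧
          (∀ ν : Fin (θ.d₆ + 1),
            HasMaj (bXH x U) (cNormR 1 (H12 x) (𝔬12 x).blk (fun y => (geo9Y_len_pos x y).le) 0) (Dd x U ν ∘ₗ (𝔬12 x).G0 U ∘ₗ (𝔬12 x).Tpi U) (fun a b => θD12 * ((geo9Y x).M * α₀) * Real.exp (-(δK12 * (geo9Y x).dist a b))) ∧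
            HasMaj (bXH x U) (cNormR 1 (H12 x) (𝔬12 x).blk (fun y => (geo9Y_len_pos x y).le) 0) (Dd x U ν ∘ₗ (𝔬12 x).G0 U ∘ₗ ((𝔬12 x).Tpi U + (𝔬12 x).T2 U)) (fun a b => θD12 * ((geo9Y x).M * α₀) * Real.exp (-(δK12 * (geo9Y x).dist a b)))) ∧
          (∀ β : ℝ, 0 ≤ β → β < 1 →
            HasMaj (bXH x U) (cNormR 1 (H12 x) (𝔭A x).blkPX (fun y => (geo9Y_len_pos x y).le) (β - 1)) (((𝔭A x).ΦX U β ∘ₗ (𝔬12 x).G0 U) ∘ₗ (𝔬12 x).Tpi U) (fun a b => θH12 β * ((geo9Y x).M * α₀) * Real.exp (-(δK12 * (geo9Y x).dist a b))) ∧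
            HasMaj (bXH x U) (cNormR 1 (H12 x) (𝔭A x).blkPX (fun y => (geo9Y_len_pos x y).le) (β - 1)) (((𝔭A x).ΦX U β ∘ₗ (𝔬12 x).G0 U) ∘ₗ ((𝔬12 x).Tpi U + (𝔬12 x).T2 U)) (fun a b => θH12 β * ((geo9Y x).M * α₀) * Real.exp (-(δK12 * (geo9Y x).dist a b)))) ∧
          (∀ (ν : Fin (θ.d₆ + 1)) (β : ℝ), 0 ≤ β → β < 1 →
            HasMaj (bXH x U) (cNormR 1 (H12 x) (𝔭A x).blkPX (fun y => (geo9Y_len_pos x y).le) β) (((𝔭A x).ΦX U β ∘ₗ Dd x U ν ∘ₗ (𝔬12 x).G0 U) ∘ₗ (𝔬12 x).Tpi U) (fun a b => θH12 β * ((geo9Y x).M * α₀) * Real.exp (-(δK12 * (geo9Y x).dist a b))) ∧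
            HasMaj (bXH x U) (cNormR 1 (H12 x) (𝔭A x).blkPX (fun y => (geo9Y_len_pos x y).le) β) (((𝔭A x).ΦX U β ∘ₗ Dd x U ν ∘ₗ (𝔬12 x).G0 U) ∘ₗ ((𝔬12 x).Tpi U + (𝔬12 x).T2 U)) (fun a b => θH12 β * ((geo9Y x).M * α₀) * Real.exp (-(δK12 * (geo9Y x).dist a b)))) ∧
          HasMaj (cNormR 1 (H12 x) (𝔬12 x).blkY (fun y => (geo9Y_len_pos x y).le) 0) (bXH x U) ((𝔬12 x).G0 U ∘ₗ (𝔬12 x).Dstar U) (fun a b => AD * Real.exp (-(δP * (geo9Y x).dist a b))) ∧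
          (∀ (μ : Fin (θ.d₆ + 1)) (ε : ℝ), 0 < ε → HasMaj (bHX12 x ε) (bXH x U) ((𝔬12 x).G0 U ∘ₗ Dds x U μ) (fun a b => AI ε * Real.exp (-(δP * (geo9Y x).dist a b)))) ∧
          HasMaj (bXH x U) (cNormR 1 (H12 x) (𝔬12 x).blk (fun y => (geo9Y_len_pos x y).le) (-1)) LinearMap.id (fun a b => CR * Real.exp (-(δP * (geo9Y x).dist a b))) ∧
          (bXH x U).κ ≤ κS ∧
          (∃ Λ : ℝ, 0 ≤ Λ ∧ ∀ (y : (geo9Y x).Site) (F : XBK (TrIdx N) x.toKIdx → ℝ), (bXH x U).loc y F ≤ Λ * ∑ q : XBK (TrIdx N) x.toKIdx, |F q|)))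
    (hst21 : ∀ x : MemberY θ.d₆ θ.ℓ₆ θ.hd' θ.hL' θ.b₀ θ.b₁ Mstar, M12 ≤ (geo9Y x).M → ∀ α₀ : ℝ, 0 < α₀ → (geo9Y x).M * α₀ ≤ a12 → ∀ U : (bg9YR (Matrix (Fin N) (Fin N) ℂ) (specialUnitaryUnits (Fin N)) R₁ R₂ x).Cfg, (bg9YR (Matrix (Fin N) (Fin N) ℂ) (specialUnitaryUnits (Fin N)) R₁ R₂ x).Reg335 c α₀ U →
      (bg9YR (Matrix (Fin N) (Fin N) ℂ) (specialUnitaryUnits (Fin N)) R₁ R₂ x).Reg336 c α₀ U →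
        (StepS (𝔬12 x) (weightNorm (bXH x U) (rwt (geo9Y x) (-1)) (rwt_nonneg (fun y => (geo9Y_len_pos x y).le) (-1))) (θS * ((geo9Y x).M * α₀)) δK12 U ∧
          HasMaj (weightNorm (bXH x U) (rwt (geo9Y x) (-1)) (rwt_nonneg (fun y => (geo9Y_len_pos x y).le) (-1))) (cNorm 1 (H12 x) (𝔬12 x).blkY (fun y => (geo9Y_len_pos x y).le) 1) ((𝔬12 x).D U ∘ₗ (𝔬12 x).G0 U ∘ₗ ((𝔬12 x).Tpi U + (𝔬12 x).T2 U)) (fun a b => θD12 * ((geo9Y x).M * α₀) * Real.exp (-(δK12 * (geo9Y x).dist a b))) ∧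
          (∀ ν : Fin (θ.d₆ + 1), HasMaj (weightNorm (bXH x U) (rwt (geo9Y x) (-1)) (rwt_nonneg (fun y => (geo9Y_len_pos x y).le) (-1))) (cNorm 1 (H12 x) (𝔬12 x).blk (fun y => (geo9Y_len_pos x y).le) 1) (Dd x U ν ∘ₗ (𝔬12 x).G0 U ∘ₗ ((𝔬12 x).Tpi U + (𝔬12 x).T2 U)) (fun a b => θD12 * ((geo9Y x).M * α₀) * Real.exp (-(δK12 * (geo9Y x).dist a b)))) ∧
          (∀ β : ℝ, 0 ≤ β → β < 1 → HasMaj (weightNorm (bXH x U) (rwt (geo9Y x) (-1)) (rwt_nonneg (fun y => (geo9Y_len_pos x y).le) (-1))) (cNormR 1 (H12 x) (𝔭A x).blkPY (fun y => (geo9Y_len_pos x y).le) (β - 1)) (((𝔭A x).ΦY U β ∘ₗ (𝔬12 x).D U ∘ₗ (𝔬12 x).G0 U) ∘ₗ ((𝔬12 x).Tpi U + (𝔬12 x).T2 U)) (fun a b => θH12 β * ((geo9Y x).M * α₀) * Real.exp (-(δK12 * (geo9Y x).dist a b)))) ∧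
          (∀ (ν : Fin (θ.d₆ + 1)) (β : ℝ), 0 ≤ β → β < 1 → HasMaj (weightNorm (bXH x U) (rwt (geo9Y x) (-1)) (rwt_nonneg (fun y => (geo9Y_len_pos x y).le) (-1))) (cNormR 1 (H12 x) (𝔭A x).blkPX (fun y => (geo9Y_len_pos x y).le) (β - 1)) (((𝔭A x).ΦX U β ∘ₗ Dd x U ν ∘ₗ (𝔬12 x).G0 U) ∘ₗ ((𝔬12 x).Tpi U + (𝔬12 x).T2 U)) (fun a b => θH12 β * ((geo9Y x).M * α₀) * Real.exp (-(δK12 * (geo9Y x).dist a b)))) ∧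
          HasMaj (cNorm 1 (H12 x) (𝔬12 x).blk (fun y => (geo9Y_len_pos x y).le) 0) (weightNorm (bXH x U) (rwt (geo9Y x) (-1)) (rwt_nonneg (fun y => (geo9Y_len_pos x y).le) (-1))) ((𝔬12 x).G0 U) (fun a b => A₀S * Real.exp (-(δP * (geo9Y x).dist a b))) ∧
          HasMaj (cNorm 1 (H12 x) (𝔬12 x).blkW (fun y => (geo9Y_len_pos x y).le) 1) (weightNorm (bXH x U) (rwt (geo9Y x) (-1)) (rwt_nonneg (fun y => (geo9Y_len_pos x y).le) (-1))) ((𝔬12 x).G0 U ∘ₗ (𝔬12 x).Dv U) (fun a b => AW * Real.exp (-(δP * (geo9Y x).dist a b))) ∧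
          HasMaj (weightNorm (BlockNorm.ofBlocks (toB6 (geo9Y x) 1 (H12 x)) (𝔬12 x).blkZ) (wZ x) (fun y => (hwZ x y).le)) (weightNorm (bXH x U) (rwt (geo9Y x) (-1)) (rwt_nonneg (fun y => (geo9Y_len_pos x y).le) (-1))) ((𝔬12 x).G0 U ∘ₗ (𝔬12 x).Qstar U) (fun a b => AQ * Real.exp (-(δP * (geo9Y x).dist a b))) ∧
          HasMaj (weightNorm (bXH x U) (rwt (geo9Y x) (-1)) (rwt_nonneg (fun y => (geo9Y_len_pos x y).le) (-1))) (cNormR 1 (H12 x) (𝔬12 x).blk (fun y => (geo9Y_len_pos x y).le) (-2)) LinearMap.id (fun a b => CR * Real.exp (-(δP * (geo9Y x).dist a b))) ∧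
          (∃ Λ : ℝ, 0 ≤ Λ ∧ ∀ (y : (geo9Y x).Site) (F : XBK (TrIdx N) x.toKIdx → ℝ), (weightNorm (bXH x U) (rwt (geo9Y x) (-1)) (rwt_nonneg (fun y => (geo9Y_len_pos x y).le) (-1))).loc y F ≤ Λ * ∑ q : XBK (TrIdx N) x.toKIdx, |F q|)))
    (hst11 : ∀ x : MemberY θ.d₆ θ.ℓ₆ θ.hd' θ.hL' θ.b₀ θ.b₁ Mstar, M12 ≤ (geo9Y x).M → ∀ α₀ : ℝ, 0 < α₀ → (geo9Y x).M * α₀ ≤ a12 → ∀ U : (bg9YR (Matrix (Fin N) (Fin N) ℂ) (specialUnitaryUnits (Fin N)) R₁ R₂ x).Cfg, (bg9YR (Matrix (Fin N) (Fin N) ℂ) (specialUnitaryUnits (Fin N)) R₁ R₂ x).Reg335 c α₀ U →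
      (bg9YR (Matrix (Fin N) (Fin N) ℂ) (specialUnitaryUnits (Fin N)) R₁ R₂ x).Reg336 c α₀ U →
        (StepS (𝔬12 x) (bXH x U) (θS * ((geo9Y x).M * α₀)) δK12 U ∧
          (∀ ν : Fin (θ.d₆ + 1), HasMaj (bXH x U) (cNormR 1 (H12 x) (𝔬12 x).blk (fun y => (geo9Y_len_pos x y).le) 0) (Dd x U ν ∘ₗ (𝔬12 x).G0 U ∘ₗ ((𝔬12 x).Tpi U + (𝔬12 x).T2 U)) (fun a b => θD12 * ((geo9Y x).M * α₀) * Real.exp (-(δK12 * (geo9Y x).dist a b)))) ∧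
          (∀ β : ℝ, 0 ≤ β → β < 1 → HasMaj (bXH x U) (cNormR 1 (H12 x) (𝔭A x).blkPX (fun y => (geo9Y_len_pos x y).le) (β - 1)) (((𝔭A x).ΦX U β ∘ₗ (𝔬12 x).G0 U) ∘ₗ ((𝔬12 x).Tpi U + (𝔬12 x).T2 U)) (fun a b => θH12 β * ((geo9Y x).M * α₀) * Real.exp (-(δK12 * (geo9Y x).dist a b)))) ∧
          (∀ (ν : Fin (θ.d₆ + 1)) (β : ℝ), 0 ≤ β → β < 1 → HasMaj (bXH x U) (cNormR 1 (H12 x) (𝔭A x).blkPX (fun y => (geo9Y_len_pos x y).le) β) (((𝔭A x).ΦX U β ∘ₗ Dd x U ν ∘ₗ (𝔬12 x).G0 U) ∘ₗ ((𝔬12 x).Tpi U + (𝔬12 x).T2 U)) (fun a b => θH12 β * ((geo9Y x).M * α₀) * Real.exp (-(δK12 * (geo9Y x).dist a b)))) ∧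
          HasMaj (cNormR 1 (H12 x) (𝔬12 x).blkY (fun y => (geo9Y_len_pos x y).le) 0) (bXH x U) ((𝔬12 x).G0 U ∘ₗ (𝔬12 x).Dstar U) (fun a b => AD * Real.exp (-(δP * (geo9Y x).dist a b))) ∧
          (∀ (μ : Fin (θ.d₆ + 1)) (ε : ℝ), 0 < ε → HasMaj (bHX12 x ε) (bXH x U) ((𝔬12 x).G0 U ∘ₗ Dds x U μ) (fun a b => AI ε * Real.exp (-(δP * (geo9Y x).dist a b)))) ∧
          (∀ ε : ℝ, 0 < ε → HasMaj (bHW13 x U ε) (bXH x U) ((𝔬12 x).G0 U ∘ₗ (𝔬12 x).Dv U) (fun a b => AV ε * Real.exp (-(δP * (geo9Y x).dist a b)))) ∧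
          HasMaj (weightNorm (BlockNorm.ofBlocks (toB6 (geo9Y x) 1 (H12 x)) (𝔬12 x).blkZ) (fun y => (geo9Y x).len y * wZ x y) (fun y => (mul_pos (geo9Y_len_pos x y) (hwZ x y)).le)) (bXH x U) ((𝔬12 x).G0 U ∘ₗ (𝔬12 x).Qstar U) (fun a b => AQ1 * Real.exp (-(δP * (geo9Y x).dist a b))) ∧
          HasMaj (bXH x U) (cNormR 1 (H12 x) (𝔬12 x).blk (fun y => (geo9Y_len_pos x y).le) (-1)) LinearMap.id (fun a b => CR * Real.exp (-(δP * (geo9Y x).dist a b))) ∧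
          (∃ Λ : ℝ, 0 ≤ Λ ∧ ∀ (y : (geo9Y x).Site) (F : XBK (TrIdx N) x.toKIdx → ℝ), (bXH x U).loc y F ≤ Λ * ∑ q : XBK (TrIdx N) x.toKIdx, |F q|)))
    : B9.Thm312Printed (θ.d₆ + 1) c geo9Y (bg9YR (Matrix (Fin N) (Fin N) ℂ) (specialUnitaryUnits (Fin N)) R₁ R₂) (fun x => kernelFamilyR R₁ R₂ ((opsYNuOfRecordV4PE N θ Mstar 𝔯 𝔢 𝔴 𝔈) x).GD) (fun x => kernelFamilyR R₁ R₂ ((opsYNuOfRecordV4PE N θ Mstar 𝔯 𝔢 𝔴 𝔈) x).G₁) (fun x => hKernelR R₁ R₂ ((opsYNuOfRecordV4PE N θ Mstar 𝔯 𝔢 𝔴 𝔈) x).H) (fun x => hKernelR R₁ R₂ ((opsYNuOfRecordV4PE N θ Mstar 𝔯 𝔢 𝔴 𝔈) x).H₁)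
        (fun x K => ((opsYNuOfRecordV4PE N θ Mstar 𝔯 𝔢 𝔴 𝔈) x).HasRWExp (kernelFamilyRY K)) (fun x K => ((opsYNuOfRecordV4PE N θ Mstar 𝔯 𝔢 𝔴 𝔈) x).HasRWExpH (hKernelRY K)) (fun x K => ((opsYNuOfRecordV4PE N θ Mstar 𝔯 𝔢 𝔴 𝔈) x).PosDefK (kernelFamilyRY K)) ∧
      B9.Thm313Printed c geo9Y (bg9YR (Matrix (Fin N) (Fin N) ℂ) (specialUnitaryUnits (Fin N)) R₁ R₂) (fun x => kernelFamilyR R₁ R₂ ((opsYNuOfRecordV4PE N θ Mstar 𝔯 𝔢 𝔴 𝔈) x).GG) (fun x K => ((opsYNuOfRecordV4PE N θ Mstar 𝔯 𝔢 𝔴 𝔈) x).HasRWExp (kernelFamilyRY K)) (fun x K => ((opsYNuOfRecordV4PE N θ Mstar 𝔯 𝔢 𝔴 𝔈) x).PosDefK (kernelFamilyRY K)) := by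
  have hL1 : (1 : ℝ) ≤ ((θ.ℓ₆ + 1 : ℕ) : ℝ) := by exact_mod_cast Nat.succ_le_succ (Nat.zero_le _)
  have hsat : ∀ (x : MemberY θ.d₆ θ.ℓ₆ θ.hd' θ.hL' θ.b₀ θ.b₁ Mstar) (n : Fin 4) (B' δ' : ℝ),
      (∀ a a' b, RelB x.toKIdx a a' → maj342 (geo9Y x) n B' δ' a b = maj342 (geo9Y x) n B' δ' a' b) ∧
      (∀ a b b', RelB x.toKIdx b b' → maj342 (geo9Y x) n B' δ' a b = maj342 (geo9Y x) n B' δ' a b') :=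
    fun x n B' δ' => ⟨fun a a' b h => maj342_relB_left x.toKIdx n B' δ' a a' b h, fun a b b' h => maj342_relB_right x.toKIdx n B' δ' a b b' h⟩
  have hmult : ∀ (x : MemberY θ.d₆ θ.ℓ₆ θ.hd' θ.hL' θ.b₀ θ.b₁ Mstar) (y' : (geo9Y x).Site),
      (Finset.univ.filter (fun y'' : (geo9Y x).Site => RelB x.toKIdx y'' y')).card ≤ 2 * (θ.d₆ + 1) := fun x y' => by
    refine le_trans (Finset.card_le_card fun c hc => ?_) (card_sameCarrier_le_kIdx x.toKIdx y')
    exact Finset.mem_filter.2 ⟨@Finset.mem_univ _ (_) c, (Finset.mem_filter.1 hc).2⟩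
  have hRdist : ∀ (x : MemberY θ.d₆ θ.ℓ₆ θ.hd' θ.hL' θ.b₀ θ.b₁ Mstar) (a a' b : (geo9Y x).Site), RelB x.toKIdx a a' → (geo9Y x).dist a b = (geo9Y x).dist a' b :=
    fun x a a' b h => dist_eq_of_relB x.toKIdx h (relB_refl x.toKIdx b)
  have hRlen : ∀ (x : MemberY θ.d₆ θ.ℓ₆ θ.hd' θ.hL' θ.b₀ θ.b₁ Mstar) (a a' : (geo9Y x).Site), RelB x.toKIdx a a' → (geo9Y x).len a = (geo9Y x).len a' :=
    fun x a a' h => len_eq_of_relB x.toKIdx h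
  -- the (3.42)∕(3.47)∕(3.133) co-readings of G_D, G₁, 𝔊, H, H₁ at the pins (`N06CoReadingsOfPins`, `B9CoReadingCoordsH`)
  letI hF : ∀ x : MemberY θ.d₆ θ.ℓ₆ θ.hd' θ.hL' θ.b₀ θ.b₁ Mstar, Fintype (B9GeoNormsKLevelV1.geo9K x.toKIdx).Site := fun x => (inferInstance : Fintype (geo9Y x).Site)
  have hGD := fun (x : MemberY θ.d₆ θ.ℓ₆ θ.hd' θ.hL' θ.b₀ θ.b₁ Mstar) (U : (bg9YR (Matrix (Fin N) (Fin N) ℂ) (specialUnitaryUnits (Fin N)) R₁ R₂ x).Cfg) => bond_coReadings3_of_pins x.toKIdx (trBasis N) (bg9YR (Matrix (Fin N) (Fin N) ℂ) (specialUnitaryUnits (Fin N)) R₁ R₂ x) (fun U => U) (lettersYOfRecordV4P N θ Mstar 𝔯 x).GD (lettersYOfRecordV4P N θ Mstar 𝔯 x).parB U (hβI x) (hlev x) (hblk12 x) (hblkY12 x) (hGco12 x U) (hDco12 x U) (hDsco12 x U)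
  have hG1 := fun (x : MemberY θ.d₆ θ.ℓ₆ θ.hd' θ.hL' θ.b₀ θ.b₁ Mstar) (U : (bg9YR (Matrix (Fin N) (Fin N) ℂ) (specialUnitaryUnits (Fin N)) R₁ R₂ x).Cfg) => bond_coReadings3_of_pins x.toKIdx (trBasis N) (bg9YR (Matrix (Fin N) (Fin N) ℂ) (specialUnitaryUnits (Fin N)) R₁ R₂ x) (fun U => U) (lettersYOfRecordV4P N θ Mstar 𝔯 x).G₁ (lettersYOfRecordV4P N θ Mstar 𝔯 x).parB U (hβI x) (hlev x) (hblk12 x) (hblkY12 x) (hG1co12 x U) (hDco12 x U) (hDsco12 x U)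
  have hGG := fun (x : MemberY θ.d₆ θ.ℓ₆ θ.hd' θ.hL' θ.b₀ θ.b₁ Mstar) (U : (bg9YR (Matrix (Fin N) (Fin N) ℂ) (specialUnitaryUnits (Fin N)) R₁ R₂ x).Cfg) => bond_coReadings3_of_pins x.toKIdx (trBasis N) (bg9YR (Matrix (Fin N) (Fin N) ℂ) (specialUnitaryUnits (Fin N)) R₁ R₂ x) (fun U => U) (lettersYOfRecordV4P N θ Mstar 𝔯 x).GG (lettersYOfRecordV4P N θ Mstar 𝔯 x).parB U (hβI x) (hlev x) (hblk12 x) (hblkY12 x) (hGGco12 x U) (hDco12 x U) (hDsco12 x U)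
  have hHH := fun (x : MemberY θ.d₆ θ.ℓ₆ θ.hd' θ.hL' θ.b₀ θ.b₁ Mstar) (U : (bg9YR (Matrix (Fin N) (Fin N) ℂ) (specialUnitaryUnits (Fin N)) R₁ R₂ x).Cfg) => coRealizesHRel_of_pins x.toKIdx (trBasis N) (bg9YR (Matrix (Fin N) (Fin N) ℂ) (specialUnitaryUnits (Fin N)) R₁ R₂ x) (fun U => U) (lettersYOfRecordV4P N θ Mstar 𝔯 x).H (lettersYOfRecordV4P N θ Mstar 𝔯 x).parB U (hβI x) (hblk12 x) (hblkY12 x) (hblkZ12 x) (hHm12 x U) (hDco12 x U)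
  have hHH1 := fun (x : MemberY θ.d₆ θ.ℓ₆ θ.hd' θ.hL' θ.b₀ θ.b₁ Mstar) (U : (bg9YR (Matrix (Fin N) (Fin N) ℂ) (specialUnitaryUnits (Fin N)) R₁ R₂ x).Cfg) => coRealizesHRel_of_pins x.toKIdx (trBasis N) (bg9YR (Matrix (Fin N) (Fin N) ℂ) (specialUnitaryUnits (Fin N)) R₁ R₂ x) (fun U => U) (lettersYOfRecordV4P N θ Mstar 𝔯 x).H₁ (lettersYOfRecordV4P N θ Mstar 𝔯 x).parB U (hβI x) (hblk12 x) (hblkY12 x) (hblkZ12 x) (hH1m12 x U) (hDco12 x U)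
  have hcoHR12 := fun (x : MemberY θ.d₆ θ.ℓ₆ θ.hd' θ.hL' θ.b₀ θ.b₁ Mstar) (U : (bg9YR (Matrix (Fin N) (Fin N) ℂ) (specialUnitaryUnits (Fin N)) R₁ R₂ x).Cfg) => And.intro (hHH x U).1 (And.intro (hHH x U).2 (And.intro (hHH1 x U).1 (hHH1 x U).2))
  have hcoR12 := fun (x : MemberY θ.d₆ θ.ℓ₆ θ.hd' θ.hL' θ.b₀ θ.b₁ Mstar) (U : (bg9YR (Matrix (Fin N) (Fin N) ℂ) (specialUnitaryUnits (Fin N)) R₁ R₂ x).Cfg) => And.intro (hGD x U).1 (And.intro (hGD x U).2.2.1 (And.intro (hG1 x U).1 (hG1 x U).2.2.1))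
  have hco1R12 := fun (x : MemberY θ.d₆ θ.ℓ₆ θ.hd' θ.hL' θ.b₀ θ.b₁ Mstar) (U : (bg9YR (Matrix (Fin N) (Fin N) ℂ) (specialUnitaryUnits (Fin N)) R₁ R₂ x).Cfg) => And.intro (hGD x U).2.1 (hG1 x U).2.1
  have hcoG12 := fun (x : MemberY θ.d₆ θ.ℓ₆ θ.hd' θ.hL' θ.b₀ θ.b₁ Mstar) (U : (bg9YR (Matrix (Fin N) (Fin N) ℂ) (specialUnitaryUnits (Fin N)) R₁ R₂ x).Cfg) => And.intro (hGD x U).2.2.2.1 (And.intro (hGD x U).2.2.2.2.1 (And.intro (hGD x U).2.2.2.2.2.1 (And.intro (hG1 x U).2.2.2.1 (And.intro (hG1 x U).2.2.2.2.1 (hG1 x U).2.2.2.2.2.1))))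
  -- row 20's twelve (3.46) L² readings of G_D, G₁ are THEOREMS on the coordinate models (`bond_l2ReadsNbr3_of_pins` + n06-k `bond_l2ReadsNbr345_of_pins` at the pinned direction letters)
  have hDL := fun (x : MemberY θ.d₆ θ.ℓ₆ θ.hd' θ.hL' θ.b₀ θ.b₁ Mstar) (U : (bg9YR (Matrix (Fin N) (Fin N) ℂ) (specialUnitaryUnits (Fin N)) R₁ R₂ x).Cfg) => bond_l2ReadsNbr3_of_pins x.toKIdx (trBasis N) (bg9YR (Matrix (Fin N) (Fin N) ℂ) (specialUnitaryUnits (Fin N)) R₁ R₂ x) (fun U => U) (lettersYOfRecordV4P N θ Mstar 𝔯 x).GD (lettersYOfRecordV4P N θ Mstar 𝔯 x).parB U (R := (1 : ℝ)) (H := H12 x) (hβI x) (hβ1 x) (hblk12 x) (hblkY12 x) (hGco12 x U) (hDco12 x U) (hDsco12 x U)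
  have hDL3 := fun (x : MemberY θ.d₆ θ.ℓ₆ θ.hd' θ.hL' θ.b₀ θ.b₁ Mstar) (U : (bg9YR (Matrix (Fin N) (Fin N) ℂ) (specialUnitaryUnits (Fin N)) R₁ R₂ x).Cfg) => bond_l2ReadsNbr345_of_pins x.toKIdx (trBasis N) (bg9YR (Matrix (Fin N) (Fin N) ℂ) (specialUnitaryUnits (Fin N)) R₁ R₂ x) (fun U => U) (lettersYOfRecordV4P N θ Mstar 𝔯 x).GD (lettersYOfRecordV4P N θ Mstar 𝔯 x).parB U (R := (1 : ℝ)) (H := H12 x) (hβI x) (hβ1 x) (hblk12 x) (hGco12 x U) (hDd x U) (hDds x U)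
  have h1L := fun (x : MemberY θ.d₆ θ.ℓ₆ θ.hd' θ.hL' θ.b₀ θ.b₁ Mstar) (U : (bg9YR (Matrix (Fin N) (Fin N) ℂ) (specialUnitaryUnits (Fin N)) R₁ R₂ x).Cfg) => bond_l2ReadsNbr3_of_pins x.toKIdx (trBasis N) (bg9YR (Matrix (Fin N) (Fin N) ℂ) (specialUnitaryUnits (Fin N)) R₁ R₂ x) (fun U => U) (lettersYOfRecordV4P N θ Mstar 𝔯 x).G₁ (lettersYOfRecordV4P N θ Mstar 𝔯 x).parB U (R := (1 : ℝ)) (H := H12 x) (hβI x) (hβ1 x) (hblk12 x) (hblkY12 x) (hG1co12 x U) (hDco12 x U) (hDsco12 x U)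
  have h1L3 := fun (x : MemberY θ.d₆ θ.ℓ₆ θ.hd' θ.hL' θ.b₀ θ.b₁ Mstar) (U : (bg9YR (Matrix (Fin N) (Fin N) ℂ) (specialUnitaryUnits (Fin N)) R₁ R₂ x).Cfg) => bond_l2ReadsNbr345_of_pins x.toKIdx (trBasis N) (bg9YR (Matrix (Fin N) (Fin N) ℂ) (specialUnitaryUnits (Fin N)) R₁ R₂ x) (fun U => U) (lettersYOfRecordV4P N θ Mstar 𝔯 x).G₁ (lettersYOfRecordV4P N θ Mstar 𝔯 x).parB U (R := (1 : ℝ)) (H := H12 x) (hβI x) (hβ1 x) (hblk12 x) (hG1co12 x U) (hDd x U) (hDds x U)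
  have hGL := fun (x : MemberY θ.d₆ θ.ℓ₆ θ.hd' θ.hL' θ.b₀ θ.b₁ Mstar) (U : (bg9YR (Matrix (Fin N) (Fin N) ℂ) (specialUnitaryUnits (Fin N)) R₁ R₂ x).Cfg) => bond_l2ReadsNbr3_of_pins x.toKIdx (trBasis N) (bg9YR (Matrix (Fin N) (Fin N) ℂ) (specialUnitaryUnits (Fin N)) R₁ R₂ x) (fun U => U) (lettersYOfRecordV4P N θ Mstar 𝔯 x).GG (lettersYOfRecordV4P N θ Mstar 𝔯 x).parB U (R := (1 : ℝ)) (H := H12 x) (hβI x) (hβ1 x) (hblk12 x) (hblkY12 x) (hGGco12 x U) (hDco12 x U) (hDsco12 x U)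
  have hGL3 := fun (x : MemberY θ.d₆ θ.ℓ₆ θ.hd' θ.hL' θ.b₀ θ.b₁ Mstar) (U : (bg9YR (Matrix (Fin N) (Fin N) ℂ) (specialUnitaryUnits (Fin N)) R₁ R₂ x).Cfg) => bond_l2ReadsNbr345_of_pins x.toKIdx (trBasis N) (bg9YR (Matrix (Fin N) (Fin N) ℂ) (specialUnitaryUnits (Fin N)) R₁ R₂ x) (fun U => U) (lettersYOfRecordV4P N θ Mstar 𝔯 x).GG (lettersYOfRecordV4P N θ Mstar 𝔯 x).parB U (R := (1 : ℝ)) (H := H12 x) (hβI x) (hβ1 x) (hblk12 x) (hGGco12 x U) (hDd x U) (hDds x U)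
  have hsym12 : ∀ x : MemberY θ.d₆ θ.ℓ₆ θ.hd' θ.hL' θ.b₀ θ.b₁ Mstar, M12 ≤ (geo9Y x).M → ∀ α₀ : ℝ, 0 < α₀ → (geo9Y x).M * α₀ ≤ a12 → ∀ U : (bg9YR (Matrix (Fin N) (Fin N) ℂ) (specialUnitaryUnits (Fin N)) R₁ R₂ x).Cfg, (bg9YR (Matrix (Fin N) (Fin N) ℂ) (specialUnitaryUnits (Fin N)) R₁ R₂ x).Reg335 c α₀ U →
      (bg9YR (Matrix (Fin N) (Fin N) ℂ) (specialUnitaryUnits (Fin N)) R₁ R₂ x).Reg336 c α₀ U → 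
        (IsTransposePair ((𝔬12 x).G U) ((𝔬12 x).G U) ∧ IsTransposePair ((𝔬12 x).G1 U) ((𝔬12 x).G1 U)) ∧
        (IsTransposePair ((𝔬12 x).D U ∘ₗ (𝔬12 x).G U) ((𝔬12 x).G U ∘ₗ (𝔬12 x).Dstar U) ∧ IsTransposePair ((𝔬12 x).D U ∘ₗ (𝔬12 x).G1 U) ((𝔬12 x).G1 U ∘ₗ (𝔬12 x).Dstar U)) :=
    fun x _ α₀ _ _ U hU _ => by
    obtain ⟨hD, h1, -⟩ := hsymD x U (mem_of_reg335R hGR x hU)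
    rw [hGco12 x U, hG1co12 x U, hDco12 x U, hDsco12 x U]
    exact ⟨⟨isTransposePair_GcoK_trBasis x.toKIdx (bg9YR (Matrix (Fin N) (Fin N) ℂ) (specialUnitaryUnits (Fin N)) R₁ R₂ x) (fun U => U) (lettersYOfRecordV4P N θ Mstar 𝔯 x).GD U hD, isTransposePair_GcoK_trBasis x.toKIdx (bg9YR (Matrix (Fin N) (Fin N) ℂ) (specialUnitaryUnits (Fin N)) R₁ R₂ x) (fun U => U) (lettersYOfRecordV4P N θ Mstar 𝔯 x).G₁ U h1⟩,
      ⟨isTransposePair_DcoK_GcoK_trBasis x.toKIdx (bg9YR (Matrix (Fin N) (Fin N) ℂ) (specialUnitaryUnits (Fin N)) R₁ R₂ x) (fun U => U) (lettersYOfRecordV4P N θ Mstar 𝔯 x).GD U hD (fun μ z => specialUnitaryUnits_le_unitaryUnits (mem_of_reg335R hGR x hU μ z)),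
        isTransposePair_DcoK_GcoK_trBasis x.toKIdx (bg9YR (Matrix (Fin N) (Fin N) ℂ) (specialUnitaryUnits (Fin N)) R₁ R₂ x) (fun U => U) (lettersYOfRecordV4P N θ Mstar 𝔯 x).G₁ U h1 (fun μ z => specialUnitaryUnits_le_unitaryUnits (mem_of_reg335R hGR x hU μ z))⟩⟩
  have hsym13 : ∀ x : MemberY θ.d₆ θ.ℓ₆ θ.hd' θ.hL' θ.b₀ θ.b₁ Mstar, M12 ≤ (geo9Y x).M → ∀ α₀ : ℝ, 0 < α₀ → (geo9Y x).M * α₀ ≤ a12 → ∀ U : (bg9YR (Matrix (Fin N) (Fin N) ℂ) (specialUnitaryUnits (Fin N)) R₁ R₂ x).Cfg, (bg9YR (Matrix (Fin N) (Fin N) ℂ) (specialUnitaryUnits (Fin N)) R₁ R₂ x).Reg335 c α₀ U →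
      (bg9YR (Matrix (Fin N) (Fin N) ℂ) (specialUnitaryUnits (Fin N)) R₁ R₂ x).Reg336 c α₀ U → IsTransposePair ((𝔬12 x).GG U) ((𝔬12 x).GG U) ∧ IsTransposePair ((𝔬12 x).D U ∘ₗ (𝔬12 x).GG U) ((𝔬12 x).GG U ∘ₗ (𝔬12 x).Dstar U) :=
    fun x _ α₀ _ _ U hU _ => by
    obtain ⟨-, -, hG⟩ := hsymD x U (mem_of_reg335R hGR x hU)
    rw [hGGco12 x U, hDco12 x U, hDsco12 x U]
    exact ⟨isTransposePair_GcoK_trBasis x.toKIdx (bg9YR (Matrix (Fin N) (Fin N) ℂ) (specialUnitaryUnits (Fin N)) R₁ R₂ x) (fun U => U) (lettersYOfRecordV4P N θ Mstar 𝔯 x).GG U hG,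
      isTransposePair_DcoK_GcoK_trBasis x.toKIdx (bg9YR (Matrix (Fin N) (Fin N) ℂ) (specialUnitaryUnits (Fin N)) R₁ R₂ x) (fun U => U) (lettersYOfRecordV4P N θ Mstar 𝔯 x).GG U hG (fun μ z => specialUnitaryUnits_le_unitaryUnits (mem_of_reg335R hGR x hU μ z))⟩
  have hcoR13 := fun (x : MemberY θ.d₆ θ.ℓ₆ θ.hd' θ.hL' θ.b₀ θ.b₁ Mstar) (U : (bg9YR (Matrix (Fin N) (Fin N) ℂ) (specialUnitaryUnits (Fin N)) R₁ R₂ x).Cfg) => And.intro (hGG x U).1 (hGG x U).2.2.1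
  have hco1R13 := fun (x : MemberY θ.d₆ θ.ℓ₆ θ.hd' θ.hL' θ.b₀ θ.b₁ Mstar) (U : (bg9YR (Matrix (Fin N) (Fin N) ℂ) (specialUnitaryUnits (Fin N)) R₁ R₂ x).Cfg) => (hGG x U).2.1
  have hcoG13 := fun (x : MemberY θ.d₆ θ.ℓ₆ θ.hd' θ.hL' θ.b₀ θ.b₁ Mstar) (U : (bg9YR (Matrix (Fin N) (Fin N) ℂ) (specialUnitaryUnits (Fin N)) R₁ R₂ x).Cfg) => And.intro (hGG x U).2.2.2.1 (And.intro (hGG x U).2.2.2.2.1 (hGG x U).2.2.2.2.2.1)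
  have hgeoOK : ∀ x : MemberY θ.d₆ θ.ℓ₆ θ.hd' θ.hL' θ.b₀ θ.b₁ Mstar, GeoOK (geo9Y x) := fun x => ⟨geo9Y_dist_triangle x, geo9Y_dist_comm x, geo9K_dist_nonneg x.toKIdx, geo9Y_len_pos x⟩
  obtain ⟨ML12, c12, hrow12⟩ := rowSum261_geo9Y (d := θ.d₆) (ℓ := θ.ℓ₆) (hd := θ.hd') (hL := θ.hL') (b₀ := θ.b₀) (b₁ := θ.b₁) (Mstar := Mstar) σ12 hσ12
  have hrow : ∀ x : MemberY θ.d₆ θ.ℓ₆ θ.hd' θ.hL' θ.b₀ θ.b₁ Mstar, ML12 ≤ (geo9Y x).M → RowSum (toB6 (geo9Y x) 1 (H12 x)) σ12 (max c12 0) := fun x hM y => (hrow12 x hM y).trans (le_max_left _ _)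
  have hE : (fun x K => ((opsYNuOfRecordV4PE N θ Mstar 𝔯 𝔢 𝔴 𝔈) x).HasRWExp (kernelFamilyRY K)) = fun x => HasRWExpOfOps (𝔬12 x) := by funext x; rw [hpinE x]; rfl
  have hH : (fun x K => ((opsYNuOfRecordV4PE N θ Mstar 𝔯 𝔢 𝔴 𝔈) x).HasRWExpH (hKernelRY K)) = fun x => HasRWExpHOfOps (𝔬12 x) := by funext x; rw [hpinH x]; rfl
  have hK' : (fun x K => ((opsYNuOfRecordV4PE N θ Mstar 𝔯 𝔢 𝔴 𝔈) x).PosDefK (kernelFamilyRY K)) = fun x => PosDefKOfOps (𝔬12 x) := by funext x; rw [hpinK x]; rfl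
  have hη : ∀ x : MemberY θ.d₆ θ.ℓ₆ θ.hd' θ.hL' θ.b₀ θ.b₁ Mstar, 0 < (geo9Y x).eta := fun x => (distOK_geo9Y x).eta_pos
  have hL21 := lemma21AboveG_geo9Y (d := θ.d₆) (ℓ := θ.ℓ₆) (hd := θ.hd') (hL := θ.hL') (b₀ := θ.b₀) (b₁ := θ.b₁) (Mstar := Mstar) H12 hα12 (hα12'.trans_lt one_half_lt_one)
  refine ⟨?_, ?_⟩
  · rw [hE, hH, hK']
    exact thm312Printed_completePairMBZSL_rates 𝔬12 (fun _ => 1) H12 𝔭A bHX12 (fun x => (Dd x)) (fun x => (Dds x)) (fun x => kernelFamilyR R₁ R₂ ((opsYNuOfRecordV4PE N θ Mstar 𝔯 𝔢 𝔴 𝔈) x).GD)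
      (fun x => kernelFamilyR R₁ R₂ ((opsYNuOfRecordV4PE N θ Mstar 𝔯 𝔢 𝔴 𝔈) x).G₁) (fun x => hKernelR R₁ R₂ ((opsYNuOfRecordV4PE N θ Mstar 𝔯 𝔢 𝔴 𝔈) x).H)
      (fun x => hKernelR R₁ R₂ ((opsYNuOfRecordV4PE N θ Mstar 𝔯 𝔢 𝔴 𝔈) x).H₁) (fun x => evBK x.toKIdx) (fun x => evBK x.toKIdx) (fun x => RelB x.toKIdx) (2 * (θ.d₆ + 1))
      (nbrCountY θ.d₆ θ.ℓ₆ θ.hd' θ.hL' θ.b₀ θ.b₁ 2) (fun x U => weightNorm (bXH x U) (rwt (geo9Y x) (-1)) (rwt_nonneg (fun y => (geo9Y_len_pos x y).le) (-1))) bXH 2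
      (Real.sqrt ((θ.d₆ + 1) * Fintype.card (TrIdx N))) ((θ.ℓ₆ + 1 : ℕ) : ℝ) θS θD12 θ2₁₂ r12 B12₀ B12₂ δ12₀ δK12 σ12 (max c12 0) ρ12 ρf12 a12 M12 ML12 B12₃ δ12₃ α12 ((θ.ℓ₆ + 1 : ℕ) : ℝ) κS A₀S CR
      δP δP AQ AD CR Bh12 Bi12 Bq12 θH12 AI Bi2₁₂ hθS hθD12 hθH12 hθ2₁₂ hr12 hB12₀ hB12₂ hB12₃ hκS hA₀S hCR hAI hδP₀ hδP₃ hσ12.le hρ12 hρP12 hρδ12 hρP12 (le_max_right _ _) ha12 hM12 hα12' hα12.le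
      hρf12 hρf1 hρf2 hBh12 hBi12 hBi2₁₂ hBq12 (Real.sqrt_nonneg _) one_le_L_nat hgeoOK (fun x => modelSignsOn_geo9K x.toKIdx) (fun _ => hL1) (fun _ => le_rfl) one_le_L_nat hη hrow hL21
      (hnbr_two_of_le hM₀) (fun x a a' h => len_le_of_dist_le_two_geo9Y x a a' h) hsat hmult hRdist hRlen hcoR12 hco1R12 hcoHR12 hcoG12
      (fun x U => ⟨⟨(hDL x U).1, (hDL x U).2.1, (hDL x U).2.2, (hDL3 x U).1, (hDL3 x U).2.1, (hDL3 x U).2.2⟩, ⟨(h1L x U).1, (h1L x U).2.1, (h1L x U).2.2, (h1L3 x U).1, (h1L3 x U).2.1, (h1L3 x U).2.2⟩⟩)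
      (fun x U => ⟨(hH1N x U).1, (hH1N x U).2.1⟩) (fun x U => ⟨(hIF x U).1, (hIF x U).2.1⟩) hHCN hsym12 hmodel12 he1
      (fun x => weightNorm (BlockNorm.ofBlocks (toB6 (geo9Y x) 1 (H12 x)) (𝔬12 x).blkZ) (wZ x) (fun y => (hwZ x y).le)) (fun _ => rfl) hlettersH12
      (fun x hM α₀ hα ha U hU hU' => ⟨(hG0C x hM α₀ hα ha U hU hU').1, (hG0C x hM α₀ hα ha U hU hU').2.2⟩) hStL hLHH hdomX hst20 hst10
  · rw [hE, hK']
    exact thm313Printed_completePairMBCZcUSX 𝔬12 (fun _ => 1) H12 (fun x => kernelFamilyR R₁ R₂ ((opsYNuOfRecordV4PE N θ Mstar 𝔯 𝔢 𝔴 𝔈) x).GG) bH13 𝔭A bHX12 Gp bXH Dd Dds bHW13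
      (fun x U => weightNorm (bXH x U) (rwt (geo9Y x) (-1)) (rwt_nonneg (fun y => (geo9Y_len_pos x y).le) (-1))) bXH (fun x => evBK x.toKIdx) (fun x => evBK x.toKIdx) (fun x => RelB x.toKIdx)
      (2 * (θ.d₆ + 1)) (nbrCountY θ.d₆ θ.ℓ₆ θ.hd' θ.hL' θ.b₀ θ.b₁ 2) 2 (Real.sqrt ((θ.d₆ + 1) * Fintype.card (TrIdx N))) ((θ.ℓ₆ + 1 : ℕ) : ℝ) θS θD12 θ2₁₂ r12 B12₀ B12₂ B13₄ δ12₀ δK12 δP σ12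
      (max c12 0) ρ12 a12 M12 ML12 B12₃ δ12₃ ρ13 α12 ((θ.ℓ₆ + 1 : ℕ) : ℝ) κ13 κS A₀S AW AQ AD AQ1 CR CR Bh12 Bi12 Bq12 BhD13 Bx13 Bd13 θH12 Br13 AI AV Bi2₁₂ Bd2₁₃ hθS hθD12 hθH12 hθ2₁₂ hκS
      hA₀S hAW hAQ hAD hAQ1 hCR hCR hAI hAV hr12 hB12₀ hB12₂ hB12₃ hB13₄ hBr13 hσ12.le hρ13 (by linarith only [hρ13ρ, hσ12]) hρ13ρ hσρ13 hρS12 (le_trans (by linarith only [hσ12]) hρ₃12)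
      hρδ12 hρP12 (le_max_right _ _) ha12 hM12 hα12.le hBi12 hBd13 hBi2₁₂ hBd2₁₃ hBh12 (fun β _ _ => hBq12 β) hBhD13 hBx13 (Real.sqrt_nonneg _) one_le_L_nat hgeoOK
      (fun x => modelSignsOn_geo9K x.toKIdx) (fun _ => hL1) (fun _ => le_rfl) hη hκ13 hκW13 hκX (fun x U => by simp only [weightNorm_κ]; exact (hκX x U).trans hκ13S)
      (fun x U => (hκX x U).trans hκ13S) (fun _ _ => rfl) hADB12 hrow hL21 (hnbr_two_of_le hM₀) (fun x a a' h => len_le_of_dist_le_two_geo9Y x a a' h) hsat hmult hcoR13 hco1R13 hcoG13 hsym13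
      (fun x U => ⟨(hGL x U).1, (hGL x U).2.1, (hGL x U).2.2, (hGL3 x U).1, (hGL3 x U).2.1, (hGL3 x U).2.2⟩) (fun x U => (hH1N x U).2.2) (fun x U => (hIF x U).2.2) hRdist hmodel12 he1 wZ hwZ
      (fun x hM α₀ hα ha U hU hU' => ⟨(hZ7 x hM α₀ hα ha U hU hU').1, (hZ7 x hM α₀ hα ha U hU hU').2.1, (hZ7 x hM α₀ hα ha U hU hU').2.2.1, hrgd2_13 x hM α₀ hα ha U hU hU',
        (hZ7 x hM α₀ hα ha U hU hU').2.2.2.1, (hZ7 x hM α₀ hα ha U hU hU').2.2.2.2.1, (hZ7 x hM α₀ hα ha U hU hU').2.2.2.2.2.1, (hZ7 x hM α₀ hα ha U hU hU').2.2.2.2.2.2⟩)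
      hwGp13 h152 hlettersD13 (fun x hM α₀ hα ha U hU hU' => ⟨(hG0C x hM α₀ hα ha U hU hU').1, (hG0C x hM α₀ hα ha U hU hU').2.1⟩) hLHH hLH3
      (fun x hM α₀ hα ha U hU hU' => (hG0C x hM α₀ hα ha U hU hU').2.2) hStL vZ hvZ hLL2 hrgdd13 hdgDvd13 hpdgDvd13 hdomX hdomW hst21 hst11

end Pointed

end Summit.QuantumFields.YangMills.BalabanUVNodes.N06Thm312313AtPinsStateSUZ7

end
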